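import Literature.NumberTheory.Sieve.PolynomialValuesSieveBounds
import Literature.NumberTheory.Sieve.SieveFrameworkFundamentalLemma
import Literature.NumberTheory.Sieve.PolynomialCongruencesRootCount
import Literature.NumberTheory.Sieve.PolynomialCongruencesRootDensity
import Literature.NumberTheory.Sieve.BoundedClassDensitySieveDimension
import Literature.NumberTheory.Sieve.RoughNumbersCoprimeProgressions
import Literature.NumberTheory.Sieve.PolynomialCongruencesPrimeModuli
import Literature.NumberTheory.LFunctions.MertensElementary
import HarnessLib

/-!
# No atom for `ω(f(n))` along an irreducible quadratic (Kubilius model + sieve)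

Topic `Literature/NumberTheory/Sieve`, companion of `PolynomialValuesSieveSequence.lean` /
`PolynomialValuesSieveBounds.lean` (polynomial values as sifted sequences) and of
`SieveFrameworkFundamentalLemma.lean` (the PROVED uniform Fundamental Lemma
`SieveSequence.fundamental_lemma_uniform_holds`). Everything here is PROVED; NO definition and no
named fact is introduced (all auxiliary objects — the independent model, the patterns, the pattern
sequences — are characterised by hypotheses `hM`, `hP`, `hpat`, `hS`, `hE`, `ha`, … and written
down only inside proofs).

## Main result

* `PolynomialOmegaNoAtom.quadratic_omega_no_atom` — for every irreducible `f ∈ ℤ[X]` of degree `2`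
  with positive leading coefficient, every `q ≥ 1`, `a`, and every `ε > 0`: for all large `x` and
  ALL `j`,  `#{1 ≤ n ≤ x : n ≡ a (mod q), ω(f(n)) = j} ≤ ε x`
  (`ω = ArithmeticFunction.cardDistinctFactors` of `(f(n)).toNat`). This is the anti-concentration
  ("no atom") half of the Erdős–Kac law for `ω(f(n))` (H. Halberstam, *On the distribution of
  additive number-theoretic functions II*, J. London Math. Soc. 31 (1956), by moments); the proof
  below is different and self-contained given the tree's sieve.

## Proof

Fix `v` and put `z = x^{1/v}`, `𝒫 = {3 ≤ p < z prime}`. For `f(n) > 0` the prime factors of `f(n)`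
are `{2} ∩`, the *pattern* `T(n) = {p ∈ 𝒫 : p ∣ f(n)}`, and at most `3v` primes `≥ z`
(`f(n) < z^{3v+1}`), so `#{n ≤ x : ω(f(n)) = j} ≤ N₀ + (3v + 2) max_i #{n : f(n) > 0, |T(n)| = i}`
(`card_omega_le`, `card_le_N0_add`). For `T ⊆ 𝒫` the count `E_T = #{n ≤ x : f(n) > 0, T(n) = T}`
is the sifting function of the **pattern sequence** (§D: the values with `d_T = ∏ T ∣ f(n)`,
indexed by the part of `rad f(n)` prime to `2d_T`, size `x ρ(d_T)/d_T`, density `ρ(m)/m` off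
`2d_T`, of sieve dimension `≤ 4` uniformly in `T` by the tree's
`BoundedClassDensity.hasSieveDimension_of_card_le`, remainders `|R_e| ≤ ρ(d_T)ρ(e) + N₀`), and the
Fundamental Lemma at level `D = x^{1/2}` gives the **Kubilius comparison**
`|E_T − x M(T)| ≤ C x M(T) e^{−v/2} + ρ(d_T) x^{1/2} e⁸ log² z + N₀ x^{1/2}` (`abs_E_sub_le`) with the
independent model `M(T) = ∏_{p ∈ T} g_p ∏_{p ∈ 𝒫 ∖ T} (1 − g_p)`, `g_p = ρ(p)/p` (§A). Summing
over `d_T ≤ x^{1/8}`, controlling `d_T > x^{1/8}` by Rankin's trick in the model (§B, with Mertens'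
`Σ_{p ≤ N} log p/p ≤ log N + log 4`, tree `MertensBound.sum_log_div_prime_le`) and by
complementation in reality, gives the **cell bound** (`cell_le`); the model itself has no atom:
`Σ_{|T| = i} M(T) ≤ (π/8σ²)^{1/2}`, `σ² = Σ g_p(1 − g_p)` (`atom_le`: Fourier inversion on
`[−1/2, 1/2]`, `|1 − g + g e(α)|² = 1 − 4g(1−g) sin² πα ≤ e^{−16 g(1−g) α²}`, Gaussian integral),
and `σ² → ∞` by the tree's split-prime bound `exists_loglog_le_sum_inv_primes_rootCount_eq_natDegree`
(`exists_var_ge`). Choosing `v = v(ε)` (`main_const_le`) and then `x` large (§F) gives the claim.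

## References

* H. Halberstam, *On the distribution of additive number-theoretic functions II*, J. London Math.
  Soc. 31 (1956) 1–14. [Halberstam1956]
* J. Kubilius, *Probabilistic methods in the theory of numbers*, AMS Transl. 11 (1964), Ch. 2.
* G. Tenenbaum, *Introduction to analytic and probabilistic number theory*, 3rd ed. (2015),
  III.3–III.4. [Tenenbaum2015]
-/

noncomputable section

open Finset Real Filter Polynomial MeasureTheory

namespace Literature.NumberTheory.Sieve

namespace PolynomialOmegaNoAtom

/-! ### A. The independent model on a finite set of primes and its largest atom

Throughout, `P` is a finite set (of primes), `g : ℕ → ℝ` the parameters, and `M T` the weight of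
the pattern `T ⊆ P`, characterised by `hM : ∀ T, M T = ∏_{p ∈ T} g(p) · ∏_{p ∈ P ∖ T} (1 − g(p))`
(a hypothesis, so that no definition is introduced). -/

section Model

variable {P : Finset ℕ} {g : ℕ → ℝ} {M : Finset ℕ → ℝ}

/-- The model weights are nonnegative when `0 ≤ g ≤ 1` on `P`. [folklore] -/
theorem M_nonneg (hM : ∀ T, M T = (∏ p ∈ T, g p) * ∏ p ∈ P \ T, (1 - g p))
    (h0 : ∀ p ∈ P, 0 ≤ g p) (h1 : ∀ p ∈ P, g p ≤ 1) {T : Finset ℕ} (hT : T ⊆ P) : 0 ≤ M T := by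
  rw [hM]
  exact mul_nonneg (Finset.prod_nonneg fun p hp => h0 p (hT hp))
    (Finset.prod_nonneg fun p hp => sub_nonneg.2 (h1 p (Finset.sdiff_subset hp)))

/-- The generating identity `Σ_T M(T) ∏_{p ∈ T} h(p) = ∏_{p ∈ P} (1 − g(p) + g(p) h(p))`. [folklore] -/
theorem sum_M_mul_prod (hM : ∀ T, M T = (∏ p ∈ T, g p) * ∏ p ∈ P \ T, (1 - g p)) (h : ℕ → ℝ) :
    ∑ T ∈ P.powerset, M T * ∏ p ∈ T, h p = ∏ p ∈ P, (1 - g p + g p * h p) := by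
  classical
  have : ∏ p ∈ P, (1 - g p + g p * h p) = ∏ p ∈ P, (g p * h p + (1 - g p)) :=
    Finset.prod_congr rfl fun p _ => add_comm _ _
  rw [this, Finset.prod_add]
  refine Finset.sum_congr rfl fun T _ => ?_
  rw [hM, Finset.prod_mul_distrib]
  ring

/-- The model weights sum to `1`. [folklore] -/
theorem sum_M_eq_one (hM : ∀ T, M T = (∏ p ∈ T, g p) * ∏ p ∈ P \ T, (1 - g p)) :
    ∑ T ∈ P.powerset, M T = 1 := by
  have h := sum_M_mul_prod hM (fun _ => 1)
  simpa using h

/-- Complex generating identity: `Σ_T M(T) w^{|T|} = ∏_{p ∈ P} (1 − g(p) + g(p) w)`. [folklore] -/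
theorem sum_M_mul_pow (hM : ∀ T, M T = (∏ p ∈ T, g p) * ∏ p ∈ P \ T, (1 - g p)) (w : ℂ) :
    ∑ T ∈ P.powerset, (M T : ℂ) * w ^ T.card =
      ∏ p ∈ P, (((1 - g p : ℝ) : ℂ) + (g p : ℂ) * w) := by
  classical
  have : ∏ p ∈ P, (((1 - g p : ℝ) : ℂ) + (g p : ℂ) * w) =
      ∏ p ∈ P, ((g p : ℂ) * w + ((1 - g p : ℝ) : ℂ)) :=
    Finset.prod_congr rfl fun p _ => add_comm _ _
  rw [this, Finset.prod_add]
  refine Finset.sum_congr rfl fun T _ => ?_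
  rw [hM, Finset.prod_mul_distrib, Finset.prod_const]
  push_cast
  ring

/-- The atoms `Σ_{|T| = i} M(T)` are nonnegative. [folklore] -/
theorem atom_nonneg (hM : ∀ T, M T = (∏ p ∈ T, g p) * ∏ p ∈ P \ T, (1 - g p))
    (h0 : ∀ p ∈ P, 0 ≤ g p) (h1 : ∀ p ∈ P, g p ≤ 1) (i : ℕ) :
    0 ≤ ∑ T ∈ P.powerset with T.card = i, M T :=
  Finset.sum_nonneg fun _ hT =>
    M_nonneg hM h0 h1 (Finset.mem_powerset.1 (Finset.mem_filter.1 hT).1)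

/-- `|e(t)| = 1` for `e(t) = exp(2πit)`. [folklore] -/
theorem norm_e (t : ℝ) : ‖Complex.exp (↑(2 * π * t) * Complex.I)‖ = 1 :=
  Complex.norm_exp_ofReal_mul_I _

/-- `e(s + t) = e(s) e(t)`. [folklore] -/
theorem e_add (s t : ℝ) : Complex.exp (↑(2 * π * (s + t)) * Complex.I) =
    Complex.exp (↑(2 * π * s) * Complex.I) * Complex.exp (↑(2 * π * t) * Complex.I) := by
  rw [← Complex.exp_add]; congr 1; push_cast; ring

/-- `e(nt) = e(t)^n`. [folklore] -/
theorem e_nat_mul (n : ℕ) (t : ℝ) : Complex.exp (↑(2 * π * (n * t)) * Complex.I) =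
    Complex.exp (↑(2 * π * t) * Complex.I) ^ n := by
  rw [← Complex.exp_nat_mul]; congr 1; push_cast; ring

/-- Orthogonality on `[−1/2, 1/2]`: `∫ e(kα) dα = [k = 0]` for `k ∈ ℤ`. [folklore] -/
theorem integral_e_int_mul (k : ℤ) :
    ∫ α in (-(1 / 2 : ℝ))..(1 / 2), Complex.exp (↑(2 * π * (k * α)) * Complex.I) =
      if k = 0 then 1 else 0 := by
  split_ifs with hk
  · subst hk
    simp only [Int.cast_zero, zero_mul, mul_zero, Complex.ofReal_zero, Complex.exp_zero,
      intervalIntegral.integral_const]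
    norm_num
  · have hc : (2 * π * k * Complex.I : ℂ) ≠ 0 := by simp [Real.pi_ne_zero, hk]
    have h : ∀ α : ℝ, Complex.exp (↑(2 * π * (k * α)) * Complex.I) =
        Complex.exp ((2 * π * k * Complex.I) * α) := by
      intro α; congr 1; push_cast; ring
    simp_rw [h, integral_exp_mul_complex hc]
    have h1 : Complex.exp (2 * π * k * Complex.I * (((1 / 2 : ℝ)) : ℂ)) =
        Complex.exp (2 * π * k * Complex.I * ((-(1 / 2) : ℝ) : ℂ)) := by
      rw [show (2 * π * k * Complex.I * (((1 / 2 : ℝ)) : ℂ)) =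
          2 * π * k * Complex.I * ((-(1 / 2) : ℝ) : ℂ) + k * (2 * π * Complex.I) by push_cast; ring,
        Complex.exp_add, Complex.exp_int_mul_two_pi_mul_I, mul_one]
    rw [h1, sub_self, zero_div]

/-- Fourier inversion: the atom is the `i`-th Fourier coefficient of the generating function. [folklore] -/
theorem atom_eq_integral (M : Finset ℕ → ℝ) (i : ℕ) :
    ((∑ T ∈ P.powerset with T.card = i, M T : ℝ) : ℂ) = ∫ α in (-(1 / 2 : ℝ))..(1 / 2),
      ∑ T ∈ P.powerset, (M T : ℂ) *
        Complex.exp (↑(2 * π * ((((T.card : ℤ) - i : ℤ) : ℝ) * α)) * Complex.I) := by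
  rw [intervalIntegral.integral_finsetSum (fun T _ => ?_)]
  · simp_rw [intervalIntegral.integral_const_mul, integral_e_int_mul]
    push_cast
    rw [Finset.sum_filter]
    refine Finset.sum_congr rfl fun T _ => ?_
    by_cases h : T.card = i
    · have : (T.card : ℤ) - i = 0 := by omega
      simp [h]
    · have : (T.card : ℤ) - i ≠ 0 := by omega
      simp [h, this]
  · exact (Continuous.mul continuous_const (by fun_prop)).intervalIntegrable _ _

/-- Jordan's inequality squared: `4α² ≤ sin²(πα)` for `|α| ≤ 1/2`. [folklore] -/
theorem four_mul_sq_le_sin_sq {α : ℝ} (hα : |α| ≤ 1 / 2) : 4 * α ^ 2 ≤ Real.sin (π * α) ^ 2 := by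
  have key : ∀ u : ℝ, 0 ≤ u → u ≤ 1 / 2 → 4 * u ^ 2 ≤ Real.sin (π * u) ^ 2 := by
    intro u hu0 hu1
    have h := Real.mul_le_sin (x := π * u) (by positivity) (by nlinarith [Real.pi_pos])
    have h2 : 2 / π * (π * u) = 2 * u := by field_simp
    rw [h2] at h
    have h3 : 0 ≤ 2 * u := by linarith
    nlinarith [h, h3]
  rcases le_or_gt 0 α with hα0 | hα0
  · exact key α hα0 (by rwa [abs_of_nonneg hα0] at hα)
  · have h := key (-α) (by linarith) (by rwa [abs_of_neg hα0] at hα)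
    have e1 : (-α) ^ 2 = α ^ 2 := by ring
    have e2 : Real.sin (π * -α) ^ 2 = Real.sin (π * α) ^ 2 := by rw [mul_neg, Real.sin_neg]; ring
    rwa [e1, e2] at h

/-- One Bernoulli factor: `|1 − c + c e(α)| ≤ exp(−8 c(1−c) α²)` for `c ∈ [0,1]`, `|α| ≤ 1/2`
(`|1 − c + c e(α)|² = 1 − 4c(1−c) sin² πα`). [folklore] -/
theorem norm_factor_le {c : ℝ} (h0 : 0 ≤ c) (h1 : c ≤ 1) {α : ℝ} (hα : |α| ≤ 1 / 2) :
    ‖((1 - c : ℝ) : ℂ) + (c : ℂ) * Complex.exp (↑(2 * π * α) * Complex.I)‖ ≤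
      Real.exp (-(8 * (c * (1 - c)) * α ^ 2)) := by
  set θ := 2 * π * α with hθ
  have hu : Complex.exp (↑θ * Complex.I) = (Real.cos θ : ℂ) + (Real.sin θ : ℂ) * Complex.I := by
    rw [Complex.exp_mul_I, ← Complex.ofReal_cos, ← Complex.ofReal_sin]
  have hz : ((1 - c : ℝ) : ℂ) + (c : ℂ) * Complex.exp (↑θ * Complex.I) =
      ((1 - c + c * Real.cos θ : ℝ) : ℂ) + ((c * Real.sin θ : ℝ) : ℂ) * Complex.I := by
    rw [hu]; push_cast; ring
  rw [hz, Complex.norm_add_mul_I]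
  refine Real.sqrt_le_iff.mpr ⟨(Real.exp_pos _).le, ?_⟩
  rw [← Real.exp_nat_mul]
  have hcs := Real.sin_sq_add_cos_sq θ
  have hcos : Real.cos θ = 1 - 2 * Real.sin (π * α) ^ 2 := by
    rw [hθ, show 2 * π * α = 2 * (π * α) by ring, Real.cos_two_mul, Real.cos_sq']; ring
  have hJ := four_mul_sq_le_sin_sq hα
  have hcc : 0 ≤ c * (1 - c) := mul_nonneg h0 (by linarith)
  calc (1 - c + c * Real.cos θ) ^ 2 + (c * Real.sin θ) ^ 2
        = 1 - 2 * (c * (1 - c)) * (1 - Real.cos θ) := by linear_combination (c ^ 2) * hcs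
    _ = 1 - 4 * (c * (1 - c)) * Real.sin (π * α) ^ 2 := by rw [hcos]; ring
    _ ≤ 1 - 16 * (c * (1 - c)) * α ^ 2 := by nlinarith [hJ, hcc]
    _ = ((2 : ℕ) : ℝ) * (-(8 * (c * (1 - c)) * α ^ 2)) + 1 := by push_cast; ring
    _ ≤ Real.exp (((2 : ℕ) : ℝ) * (-(8 * (c * (1 - c)) * α ^ 2))) := Real.add_one_le_exp _

/-- The generating function is bounded by a Gaussian: `|∏ (1 − g + g e(α))| ≤ exp(−8 σ² α²)`,
`σ² = Σ g(1 − g)`. [folklore] -/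
theorem norm_prod_factor_le (h0 : ∀ p ∈ P, 0 ≤ g p) (h1 : ∀ p ∈ P, g p ≤ 1) {α : ℝ}
    (hα : |α| ≤ 1 / 2) :
    ‖∏ p ∈ P, (((1 - g p : ℝ) : ℂ) + (g p : ℂ) * Complex.exp (↑(2 * π * α) * Complex.I))‖ ≤
      Real.exp (-(8 * (∑ p ∈ P, g p * (1 - g p)) * α ^ 2)) := by
  rw [norm_prod, show -(8 * (∑ p ∈ P, g p * (1 - g p)) * α ^ 2) =
      ∑ p ∈ P, (-(8 * (g p * (1 - g p)) * α ^ 2)) by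
    rw [Finset.mul_sum, Finset.sum_mul, ← Finset.sum_neg_distrib], Real.exp_sum]
  exact Finset.prod_le_prod (fun p _ => norm_nonneg _) fun p hp => norm_factor_le (h0 p hp) (h1 p hp) hα

/-- **The independent model has no atom**: `Σ_{|T| = i} M(T) ≤ (π / (8σ²))^{1/2}` when
`σ² = Σ_{p ∈ P} g(p)(1 − g(p)) > 0` (Fourier inversion on `[−1/2, 1/2]`, the Gaussian bound for the
generating function, and the Gaussian integral). [folklore] -/
theorem atom_le (hM : ∀ T, M T = (∏ p ∈ T, g p) * ∏ p ∈ P \ T, (1 - g p))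
    (h0 : ∀ p ∈ P, 0 ≤ g p) (h1 : ∀ p ∈ P, g p ≤ 1) (hv : 0 < ∑ p ∈ P, g p * (1 - g p)) (i : ℕ) :
    ∑ T ∈ P.powerset with T.card = i, M T ≤ Real.sqrt (π / (8 * ∑ p ∈ P, g p * (1 - g p))) := by
  have hI := atom_eq_integral (P := P) M i
  have hpt : ∀ α : ℝ, ∑ T ∈ P.powerset, (M T : ℂ) *
      Complex.exp (↑(2 * π * ((((T.card : ℤ) - i : ℤ) : ℝ) * α)) * Complex.I) =
      (∏ p ∈ P, (((1 - g p : ℝ) : ℂ) + (g p : ℂ) * Complex.exp (↑(2 * π * α) * Complex.I))) *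
        Complex.exp (↑(2 * π * (-(i * α))) * Complex.I) := by
    intro α
    rw [← sum_M_mul_pow hM, Finset.sum_mul]
    refine Finset.sum_congr rfl fun T _ => ?_
    rw [show (((T.card : ℤ) - i : ℤ) : ℝ) * α = (T.card : ℕ) * α + -(i * α) by push_cast; ring,
      e_add, e_nat_mul]
    ring
  have hnorm : ∀ α : ℝ, |α| ≤ 1 / 2 →
      ‖∑ T ∈ P.powerset, (M T : ℂ) *
        Complex.exp (↑(2 * π * ((((T.card : ℤ) - i : ℤ) : ℝ) * α)) * Complex.I)‖ ≤
        Real.exp (-(8 * (∑ p ∈ P, g p * (1 - g p)) * α ^ 2)) := by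
    intro α hα
    rw [hpt, norm_mul, norm_e, mul_one]
    exact norm_prod_factor_le h0 h1 hα
  have hatom0 := atom_nonneg hM h0 h1 i
  have hint : Integrable (fun α : ℝ => Real.exp (-(8 * (∑ p ∈ P, g p * (1 - g p)) * α ^ 2))) := by
    have := integrable_exp_neg_mul_sq (b := 8 * ∑ p ∈ P, g p * (1 - g p)) (by positivity)
    refine this.congr (Filter.Eventually.of_forall fun x => ?_)
    simp only [neg_mul]
  calc ∑ T ∈ P.powerset with T.card = i, M T
      = ‖((∑ T ∈ P.powerset with T.card = i, M T : ℝ) : ℂ)‖ := by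
        rw [Complex.norm_real, Real.norm_of_nonneg hatom0]
    _ = ‖∫ α in (-(1 / 2 : ℝ))..(1 / 2), ∑ T ∈ P.powerset, (M T : ℂ) *
          Complex.exp (↑(2 * π * ((((T.card : ℤ) - i : ℤ) : ℝ) * α)) * Complex.I)‖ := by rw [hI]
    _ ≤ ∫ α in (-(1 / 2 : ℝ))..(1 / 2), ‖∑ T ∈ P.powerset, (M T : ℂ) *
          Complex.exp (↑(2 * π * ((((T.card : ℤ) - i : ℤ) : ℝ) * α)) * Complex.I)‖ :=
        intervalIntegral.norm_integral_le_integral_norm (by norm_num)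
    _ ≤ ∫ α in (-(1 / 2 : ℝ))..(1 / 2), Real.exp (-(8 * (∑ p ∈ P, g p * (1 - g p)) * α ^ 2)) := by
        refine intervalIntegral.integral_mono_on (by norm_num) ?_ ?_ fun α hα => hnorm α ?_
        · exact (Continuous.norm (by fun_prop)).intervalIntegrable _ _
        · exact (by fun_prop : Continuous fun α : ℝ =>
            Real.exp (-(8 * (∑ p ∈ P, g p * (1 - g p)) * α ^ 2))).intervalIntegrable _ _
        · rw [abs_le]; exact ⟨by linarith [hα.1], hα.2⟩
    _ ≤ ∫ α, Real.exp (-(8 * (∑ p ∈ P, g p * (1 - g p)) * α ^ 2)) := by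
        rw [intervalIntegral.integral_of_le (by norm_num)]
        exact setIntegral_le_integral hint (Filter.Eventually.of_forall fun α => (Real.exp_pos _).le)
    _ = Real.sqrt (π / (8 * ∑ p ∈ P, g p * (1 - g p))) := by
        rw [← integral_gaussian]
        refine integral_congr_ae (Filter.Eventually.of_forall fun α => ?_)
        simp only [neg_mul]

end Model

/-! ### B. Rankin's trick in the model: patterns with a large product are rare -/

section Rankin

variable {P : Finset ℕ} {g : ℕ → ℝ} {M : Finset ℕ → ℝ}

/-- The `t`-th moment of `d_T = ∏ T` in the model: `Σ_T M(T) d_T^t = ∏ (1 − g + g p^t)`. [folklore] -/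
theorem sum_M_mul_rpow (hM : ∀ T, M T = (∏ p ∈ T, g p) * ∏ p ∈ P \ T, (1 - g p)) (t : ℝ) :
    ∑ T ∈ P.powerset, M T * (((∏ p ∈ T, p : ℕ)) : ℝ) ^ t =
      ∏ p ∈ P, (1 - g p + g p * (p : ℝ) ^ t) := by
  rw [← sum_M_mul_prod hM]
  refine Finset.sum_congr rfl fun T _ => ?_
  rw [Nat.cast_prod, ← Real.finsetProd_rpow _ _ (fun p _ => Nat.cast_nonneg p)]

/-- Rankin: `Σ_{T : d_T > Y} M(T) ≤ Y^{-t} ∏_{p ∈ P} (1 − g(p) + g(p) p^t)`. [folklore] -/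
theorem sum_M_filter_lt_le (hM : ∀ T, M T = (∏ p ∈ T, g p) * ∏ p ∈ P \ T, (1 - g p))
    (h0 : ∀ p ∈ P, 0 ≤ g p) (h1 : ∀ p ∈ P, g p ≤ 1) {Y t : ℝ} (hY : 0 < Y) (ht : 0 ≤ t) :
    ∑ T ∈ P.powerset with Y < (((∏ p ∈ T, p : ℕ)) : ℝ), M T ≤
      Y ^ (-t) * ∏ p ∈ P, (1 - g p + g p * (p : ℝ) ^ t) := by
  rw [← sum_M_mul_rpow hM, Finset.mul_sum]
  calc ∑ T ∈ P.powerset with Y < (((∏ p ∈ T, p : ℕ)) : ℝ), M T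
      ≤ ∑ T ∈ P.powerset with Y < (((∏ p ∈ T, p : ℕ)) : ℝ),
          Y ^ (-t) * (M T * (((∏ p ∈ T, p : ℕ)) : ℝ) ^ t) := by
        refine Finset.sum_le_sum fun T hT => ?_
        obtain ⟨hTP, hYT⟩ := Finset.mem_filter.1 hT
        have hM0 := M_nonneg hM h0 h1 (Finset.mem_powerset.1 hTP)
        have hq : 1 ≤ (((∏ p ∈ T, p : ℕ)) : ℝ) / Y := by rw [le_div_iff₀ hY]; linarith
        calc M T ≤ M T * (((((∏ p ∈ T, p : ℕ)) : ℝ) / Y) ^ t) :=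
              le_mul_of_one_le_right hM0 (Real.one_le_rpow hq ht)
          _ = Y ^ (-t) * (M T * (((∏ p ∈ T, p : ℕ)) : ℝ) ^ t) := by
              rw [Real.div_rpow (Nat.cast_nonneg _) hY.le, Real.rpow_neg hY.le]; ring
    _ ≤ ∑ T ∈ P.powerset, Y ^ (-t) * (M T * (((∏ p ∈ T, p : ℕ)) : ℝ) ^ t) :=
        Finset.sum_le_sum_of_subset_of_nonneg (Finset.filter_subset _ _) fun T hT _ => by
          have hM0 := M_nonneg hM h0 h1 (Finset.mem_powerset.1 hT); positivity

/-- `∏ (1 − g + g p^t) ≤ exp(Σ g (p^t − 1))` (for `p ≥ 1`, `t ≥ 0`, `g ≥ 0`). [folklore] -/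
theorem prod_le_exp_sum (h0 : ∀ p ∈ P, 0 ≤ g p) (hP : ∀ p ∈ P, 1 ≤ p) {t : ℝ} (ht : 0 ≤ t) :
    ∏ p ∈ P, (1 - g p + g p * (p : ℝ) ^ t) ≤ Real.exp (∑ p ∈ P, g p * ((p : ℝ) ^ t - 1)) := by
  rw [Real.exp_sum]
  have hpt : ∀ p ∈ P, 1 ≤ (p : ℝ) ^ t := fun p hp =>
    Real.one_le_rpow (by exact_mod_cast hP p hp) ht
  refine Finset.prod_le_prod (fun p hp => ?_) fun p hp => ?_
  · have := h0 p hp; have := hpt p hp; nlinarith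
  · have h := Real.add_one_le_exp (g p * ((p : ℝ) ^ t - 1))
    linarith

/-- Convexity: `e^u − 1 ≤ (e − 1) u` on `[0, 1]`. [folklore] -/
theorem exp_sub_one_le {u : ℝ} (hu0 : 0 ≤ u) (hu1 : u ≤ 1) :
    Real.exp u - 1 ≤ (Real.exp 1 - 1) * u := by
  have h := convexOn_exp.2 (Set.mem_univ (0 : ℝ)) (Set.mem_univ (1 : ℝ))
    (show (0 : ℝ) ≤ 1 - u by linarith) hu0 (show (1 - u) + u = 1 by ring)
  simp only [smul_eq_mul, mul_zero, zero_add, mul_one, Real.exp_zero] at h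
  linarith

/-- The exponent in Rankin's trick at `t = 1/L`: if `g(p) ≤ 2/p` and `log p ≤ L` on `P`, then
`Σ_{p ∈ P} g(p)(p^{1/L} − 1) ≤ (2(e−1)/L) Σ_{p ∈ P} log p / p`. [folklore] -/
theorem sum_rankin_exponent_le (h2 : ∀ p ∈ P, g p ≤ 2 / p) (hP : ∀ p ∈ P, 1 ≤ p)
    {L : ℝ} (hL : 0 < L) (hlog : ∀ p ∈ P, Real.log p ≤ L) :
    ∑ p ∈ P, g p * ((p : ℝ) ^ (1 / L) - 1) ≤
      2 * (Real.exp 1 - 1) / L * ∑ p ∈ P, Real.log p / p := by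
  rw [Finset.mul_sum]
  refine Finset.sum_le_sum fun p hp => ?_
  have hp1 : (1 : ℝ) ≤ p := by exact_mod_cast hP p hp
  have hp0 : (0 : ℝ) < p := by linarith
  have hlp : 0 ≤ Real.log p := Real.log_nonneg hp1
  have hu1 : Real.log p / L ≤ 1 := by rw [div_le_one hL]; exact hlog p hp
  have hpow : (p : ℝ) ^ (1 / L) - 1 ≤ (Real.exp 1 - 1) * (Real.log p / L) := by
    rw [Real.rpow_def_of_pos hp0, show Real.log p * (1 / L) = Real.log p / L by ring]
    exact exp_sub_one_le (div_nonneg hlp hL.le) hu1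
  have hpow0 : 0 ≤ (p : ℝ) ^ (1 / L) - 1 := by
    have := Real.one_le_rpow hp1 (show (0 : ℝ) ≤ 1 / L by positivity); linarith
  calc g p * ((p : ℝ) ^ (1 / L) - 1) ≤ (2 / p) * ((Real.exp 1 - 1) * (Real.log p / L)) :=
        mul_le_mul (h2 p hp) hpow hpow0 (by positivity)
    _ = 2 * (Real.exp 1 - 1) / L * (Real.log p / p) := by field_simp

/-- **Rankin tail bound** for `P ⊆ {p prime : p ≤ N}`, `g(p) ≤ 2/p`, `2 ≤ N`:
`Σ_{T : d_T > Y} M(T) ≤ Y^{−1/log N} · exp(2(e−1)(log N + log 4)/log N)` (Mertens'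
`Σ_{p ≤ N} log p / p ≤ log N + log 4`). [folklore] -/
theorem rankin_tail_le (hM : ∀ T, M T = (∏ p ∈ T, g p) * ∏ p ∈ P \ T, (1 - g p))
    (h0 : ∀ p ∈ P, 0 ≤ g p) (h1 : ∀ p ∈ P, g p ≤ 1)
    (h2 : ∀ p ∈ P, g p ≤ 2 / p) {N : ℕ} (hN : 2 ≤ N) (hP : P ⊆ Nat.primesLE N) {Y : ℝ}
    (hY : 0 < Y) :
    ∑ T ∈ P.powerset with Y < (((∏ p ∈ T, p : ℕ)) : ℝ), M T ≤
      Y ^ (-(1 / Real.log N)) *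
        Real.exp (2 * (Real.exp 1 - 1) / Real.log N * (Real.log N + Real.log 4)) := by
  have hN1 : (1 : ℝ) < N := by exact_mod_cast hN
  have hL : 0 < Real.log N := Real.log_pos hN1
  have hPp : ∀ p ∈ P, p.Prime := fun p hp => (Nat.mem_primesLE.1 (hP hp)).2
  have hP1 : ∀ p ∈ P, 1 ≤ p := fun p hp => (hPp p hp).one_lt.le
  have hlog : ∀ p ∈ P, Real.log p ≤ Real.log N := fun p hp =>
    Real.log_le_log (by exact_mod_cast (hPp p hp).pos) (by exact_mod_cast (Nat.mem_primesLE.1 (hP hp)).1)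
  refine (sum_M_filter_lt_le hM h0 h1 (t := 1 / Real.log N) hY (by positivity)).trans ?_
  refine mul_le_mul_of_nonneg_left ?_ (Real.rpow_nonneg hY.le _)
  refine (prod_le_exp_sum h0 hP1 (by positivity)).trans (Real.exp_le_exp.2 ?_)
  refine (sum_rankin_exponent_le h2 hP1 hL hlog).trans ?_
  have he : 0 ≤ Real.exp 1 - 1 := by linarith [Real.add_one_le_exp (1 : ℝ)]
  refine mul_le_mul_of_nonneg_left ?_ (div_nonneg (mul_nonneg zero_le_two he) hL.le)
  calc ∑ p ∈ P, Real.log p / p ≤ ∑ p ∈ Nat.primesLE N, Real.log p / p :=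
        Finset.sum_le_sum_of_subset_of_nonneg hP fun p hp _ => by
          have := (Nat.mem_primesLE.1 hp).2
          exact div_nonneg (Real.log_nonneg (by exact_mod_cast this.one_lt.le)) (Nat.cast_nonneg _)
    _ ≤ Real.log N + Real.log 4 := Literature.NumberTheory.LFunctions.MertensBound.sum_log_div_prime_le N

end Rankin

/-! ### C. Patterns of odd primes below `z` in the values of `f`

From here on `f ∈ ℤ[X]`, `x : ℕ` is the range and `z : ℝ` the sieve level. The finite sets and
counting functions are characterised by hypotheses (no definition is introduced):
`P = {3 ≤ p < z prime}` (`hP`), the pattern `pat n = {p ∈ P : p ∣ f(n)}` (`hpat`), the index set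
`S = {1 ≤ n ≤ x : f(n) > 0}` (`hS`) and the pattern counts `E T = #{n ∈ S : pat n = T}` (`hE`). -/

section Pattern

variable {f : ℤ[X]} {x : ℕ} {z : ℝ} {P : Finset ℕ} {pat : ℕ → Finset ℕ} {S : Finset ℕ}
  {E : Finset ℕ → ℕ}

/-- Membership in `P = {3 ≤ p < ⌈z⌉ prime}`. [folklore] -/
theorem mem_P (hP : P = (Nat.primesBelow ⌈z⌉₊).filter (fun p => 3 ≤ p)) {p : ℕ} :
    p ∈ P ↔ p.Prime ∧ 3 ≤ p ∧ p < ⌈z⌉₊ := by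
  rw [hP]
  simp only [Finset.mem_filter, Nat.mem_primesBelow]
  tauto

/-- Members of `P` are prime. [folklore] -/
theorem prime_of_mem_P (hP : P = (Nat.primesBelow ⌈z⌉₊).filter (fun p => 3 ≤ p)) {p : ℕ}
    (hp : p ∈ P) : p.Prime :=
  ((mem_P hP).1 hp).1

/-- The pattern consists of odd primes below `z`. [folklore] -/
theorem pat_subset (hP : P = (Nat.primesBelow ⌈z⌉₊).filter (fun p => 3 ≤ p))
    (hpat : ∀ n, pat n = ((f.eval (n : ℤ)).toNat.primeFactors).filter (fun p => 3 ≤ p ∧ p < ⌈z⌉₊))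
    (n : ℕ) : pat n ⊆ P := by
  intro p hp
  rw [hpat, Finset.mem_filter] at hp
  exact (mem_P hP).2 ⟨Nat.prime_of_mem_primeFactors hp.1, hp.2.1, hp.2.2⟩

/-- `#S ≤ x`. [folklore] -/
theorem card_S_le (hS : S = (Ioc 0 x).filter (fun n : ℕ => 0 < f.eval (n : ℤ))) : #S ≤ x := by
  rw [hS]
  exact (Finset.card_filter_le _ _).trans (by simp)

/-- The pattern counts partition `S`: `Σ_T E_T = #S`. [folklore] -/
theorem sum_E_eq (hP : P = (Nat.primesBelow ⌈z⌉₊).filter (fun p => 3 ≤ p))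
    (hpat : ∀ n, pat n = ((f.eval (n : ℤ)).toNat.primeFactors).filter (fun p => 3 ≤ p ∧ p < ⌈z⌉₊))
    (hE : ∀ T, E T = #(S.filter (fun n => pat n = T))) :
    ∑ T ∈ P.powerset, E T = #S := by
  simp_rw [hE]
  rw [Finset.sum_card_fiberwise_eq_card_filter]
  congr 1
  exact Finset.filter_true_of_mem fun n _ => Finset.mem_powerset.2 (pat_subset hP hpat n)

/-- A cell `#{n ∈ S : |pat(n)| = i}` is the sum of the `E_T` over `|T| = i`. [folklore] -/
theorem card_filter_card_pat_eq (hP : P = (Nat.primesBelow ⌈z⌉₊).filter (fun p => 3 ≤ p))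
    (hpat : ∀ n, pat n = ((f.eval (n : ℤ)).toNat.primeFactors).filter (fun p => 3 ≤ p ∧ p < ⌈z⌉₊))
    (hE : ∀ T, E T = #(S.filter (fun n => pat n = T))) (i : ℕ) :
    #(S.filter (fun n => (pat n).card = i)) = ∑ T ∈ P.powerset with T.card = i, E T := by
  simp_rw [hE]
  rw [Finset.card_eq_sum_card_fiberwise (f := pat) (s := S.filter _)
    (t := P.powerset.filter (fun T => T.card = i))]
  · refine Finset.sum_congr rfl fun T hT => ?_
    have hTi := (Finset.mem_filter.1 hT).2
    congr 1
    ext n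
    simp only [Finset.mem_filter]
    constructor
    · rintro ⟨⟨h1, _⟩, h3⟩; exact ⟨h1, h3⟩
    · rintro ⟨h1, h3⟩; exact ⟨⟨h1, h3 ▸ hTi⟩, h3⟩
  · intro n hn
    have hn' := Finset.mem_filter.1 (Finset.mem_coe.1 hn)
    exact Finset.mem_coe.2 (Finset.mem_filter.2 ⟨Finset.mem_powerset.2 (pat_subset hP hpat n), hn'.2⟩)

/-- For a finite set `U` of primes and `m ≠ 0`: `∏ U ∣ m ↔ U ⊆ primeFactors m`. [folklore] -/
theorem prod_primes_dvd_iff {U : Finset ℕ} (hU : ∀ p ∈ U, p.Prime) {m : ℕ} (hm : m ≠ 0) :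
    ∏ p ∈ U, p ∣ m ↔ U ⊆ m.primeFactors := by
  have h := Nat.prod_primeFactors_dvd_iff (n := ∏ p ∈ U, p) hm
  rwa [Nat.primeFactors_prod hU] at h

/-- For squarefree `e` and `m ≠ 0`: `e ∣ m ↔ primeFactors e ⊆ primeFactors m`. [folklore] -/
theorem squarefree_dvd_iff {e m : ℕ} (he : Squarefree e) (hm : m ≠ 0) :
    e ∣ m ↔ e.primeFactors ⊆ m.primeFactors := by
  conv_lhs => rw [← Nat.prod_primeFactors_of_squarefree he]
  exact Nat.prod_primeFactors_dvd_iff hm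

/-- A prime divides a product of primes iff it is one of them. [folklore] -/
theorem prime_dvd_prod_primes_iff {U : Finset ℕ} (hU : ∀ p ∈ U, p.Prime) {q : ℕ} (hq : q.Prime) :
    q ∣ ∏ p ∈ U, p ↔ q ∈ U := by
  rw [Prime.dvd_finsetProd_iff hq.prime]
  constructor
  · rintro ⟨p, hp, hqp⟩
    rwa [(Nat.prime_dvd_prime_iff_eq hq (hU p hp)).1 hqp]
  · intro h; exact ⟨q, h, dvd_rfl⟩

end Pattern

/-! ### D. The pattern counts `E_T` as sifting functions

For a pattern `T` (with `d_T = ∏ T`) the **pattern sequence** is any sifted sequence `A` (tree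
`SieveSequence`) whose weights, size and density are (`ha`, `hsize`, `hdens`): `a_v` = the number of
`n ∈ S` with `d_T ∣ f(n)` and index `idx n = v`, where `idx n` is the part of `rad f(n)` prime to
`2 d_T` (`hidx`); `X = x ρ(d_T)/d_T`; `g(m) = ρ(m)/m` for `(m, 2 d_T) = 1` and `0` otherwise. Such an
`A` is written down in `abs_E_sub_le`. -/

section SeqA

variable {f : ℤ[X]} {x : ℕ} {z : ℝ} {P : Finset ℕ} {pat : ℕ → Finset ℕ} {S : Finset ℕ}
  {E : Finset ℕ → ℕ} {T : Finset ℕ} {idx : ℕ → ℕ} {A : SieveSequence} {Xb : ℝ}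

/-- The index is positive. [folklore] -/
theorem idx_pos (hidx : ∀ n, idx n =
      ∏ p ∈ ((f.eval (n : ℤ)).toNat.primeFactors).filter (fun q => ¬ q ∣ 2 * ∏ p ∈ T, p), p)
    (n : ℕ) : 0 < idx n := by
  rw [hidx]
  exact Finset.prod_pos fun _ hp => (Nat.prime_of_mem_primeFactors (Finset.mem_filter.1 hp).1).pos

/-- The index is at most the value `f(n)` (when positive). [folklore] -/
theorem idx_le (hidx : ∀ n, idx n =
      ∏ p ∈ ((f.eval (n : ℤ)).toNat.primeFactors).filter (fun q => ¬ q ∣ 2 * ∏ p ∈ T, p), p)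
    {n : ℕ} (hn : 0 < f.eval (n : ℤ)) : idx n ≤ (f.eval (n : ℤ)).toNat := by
  have h0 : (f.eval (n : ℤ)).toNat ≠ 0 := by rw [Ne, Int.toNat_eq_zero]; omega
  rw [hidx]
  calc ∏ p ∈ ((f.eval (n : ℤ)).toNat.primeFactors).filter (fun q => ¬ q ∣ 2 * ∏ p ∈ T, p), p
      ≤ ∏ p ∈ (f.eval (n : ℤ)).toNat.primeFactors, p :=
        Finset.prod_le_prod_of_subset_of_one_le' (Finset.filter_subset _ _)
          fun p hp _ => (Nat.prime_of_mem_primeFactors hp).one_lt.le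
    _ ≤ _ := Nat.le_of_dvd (Nat.pos_of_ne_zero h0) (Nat.prod_primeFactors_dvd _)

/-- For squarefree `e`: `e ∣ idx(n) ↔ primeFactors e ⊆ {p ∣ f(n) prime : p ∤ 2 d_T}`. [folklore] -/
theorem dvd_idx_iff (hidx : ∀ n, idx n =
      ∏ p ∈ ((f.eval (n : ℤ)).toNat.primeFactors).filter (fun q => ¬ q ∣ 2 * ∏ p ∈ T, p), p)
    {e : ℕ} (he : Squarefree e) (n : ℕ) :
    e ∣ idx n ↔ e.primeFactors ⊆
      ((f.eval (n : ℤ)).toNat.primeFactors).filter (fun q => ¬ q ∣ 2 * ∏ p ∈ T, p) := by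
  rw [hidx]
  conv_lhs => rw [← Nat.prod_primeFactors_of_squarefree he]
  have hU : ∀ p ∈ ((f.eval (n : ℤ)).toNat.primeFactors).filter (fun q => ¬ q ∣ 2 * ∏ p ∈ T, p),
      p.Prime := fun p hp => Nat.prime_of_mem_primeFactors (Finset.mem_filter.1 hp).1
  have hne : ∏ p ∈ ((f.eval (n : ℤ)).toNat.primeFactors).filter (fun q => ¬ q ∣ 2 * ∏ p ∈ T, p), p ≠ 0 :=
    Finset.prod_ne_zero_iff.2 fun p hp => (hU p hp).ne_zero
  rw [Nat.prod_primeFactors_dvd_iff hne, Nat.primeFactors_prod hU]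

/-- Squarefree `e` coprime to `2 d_T` divides `idx(n)` iff it divides `f(n)` (`f(n) > 0`). [folklore] -/
theorem dvd_idx_iff_of_coprime (hidx : ∀ n, idx n =
      ∏ p ∈ ((f.eval (n : ℤ)).toNat.primeFactors).filter (fun q => ¬ q ∣ 2 * ∏ p ∈ T, p), p)
    {e : ℕ} (he : Squarefree e) (hec : e.Coprime (2 * ∏ p ∈ T, p)) {n : ℕ}
    (hn : 0 < f.eval (n : ℤ)) : e ∣ idx n ↔ e ∣ (f.eval (n : ℤ)).toNat := by
  have h0 : (f.eval (n : ℤ)).toNat ≠ 0 := by rw [Ne, Int.toNat_eq_zero]; omega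
  rw [dvd_idx_iff hidx he, squarefree_dvd_iff he h0]
  constructor
  · intro h p hp; exact (Finset.mem_filter.1 (h hp)).1
  · intro h p hp
    refine Finset.mem_filter.2 ⟨h hp, fun hpd => ?_⟩
    have hpe : p ∣ e := Nat.dvd_of_mem_primeFactors hp
    have hp1 := (Nat.prime_of_mem_primeFactors hp).one_lt
    have hp' : p.Coprime (2 * ∏ p ∈ T, p) := Nat.Coprime.coprime_dvd_left hpe hec
    exact absurd (Nat.Coprime.eq_one_of_dvd hp' hpd) hp1.ne'

/-- If `e` is not coprime to `2 d_T`, it never divides `idx(n)`. [folklore] -/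
theorem not_dvd_idx_of_not_coprime (hidx : ∀ n, idx n =
      ∏ p ∈ ((f.eval (n : ℤ)).toNat.primeFactors).filter (fun q => ¬ q ∣ 2 * ∏ p ∈ T, p), p)
    {e : ℕ} (he : Squarefree e) (hec : ¬ e.Coprime (2 * ∏ p ∈ T, p)) (n : ℕ) : ¬ e ∣ idx n := by
  rw [dvd_idx_iff hidx he]
  obtain ⟨p, hp, hpe, hpd⟩ := Nat.Prime.not_coprime_iff_dvd.1 hec
  intro h
  have := Finset.mem_filter.1 (h (Nat.mem_primeFactors.2 ⟨hp, hpe, he.ne_zero⟩))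
  exact this.2 hpd

/-- Restricting a multiplicative function to the integers prime to `k` (value `0` elsewhere) keeps it
multiplicative. [folklore] -/
theorem isMultiplicative_of_restrict {g g' : ArithmeticFunction ℝ} (hg : g.IsMultiplicative) (k : ℕ)
    (hg' : ∀ m, g' m = if m.Coprime k then g m else 0) : g'.IsMultiplicative := by
  refine ⟨?_, ?_⟩
  · rw [hg', if_pos (Nat.coprime_one_left _)]; exact hg.1
  · intro m n hmn
    simp only [hg', Nat.coprime_mul_iff_left]
    by_cases hm : m.Coprime k
    · by_cases hn : n.Coprime k
      · rw [if_pos ⟨hm, hn⟩, if_pos hm, if_pos hn]; exact hg.2 hmn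
      · rw [if_neg (fun h => hn h.2), if_neg hn, mul_zero]
    · rw [if_neg (fun h => hm h.1), if_neg hm, zero_mul]

/-- Every index lies in `(0, Xb]`, `Xb = Σ_{n ≤ x} f(n)⁺`. [folklore] -/
theorem idx_mem_Ioc (hS : S = (Ioc 0 x).filter (fun n : ℕ => 0 < f.eval (n : ℤ)))
    (hidx : ∀ n, idx n =
      ∏ p ∈ ((f.eval (n : ℤ)).toNat.primeFactors).filter (fun q => ¬ q ∣ 2 * ∏ p ∈ T, p), p)
    (hXb : Xb = ((∑ n ∈ Ioc 0 x, (f.eval (n : ℤ)).toNat : ℕ) : ℝ)) {n : ℕ} (hn : n ∈ S) :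
    idx n ∈ Ioc 0 ⌊Xb⌋₊ := by
  rw [hXb, Nat.floor_natCast, Finset.mem_Ioc]
  rw [hS] at hn
  obtain ⟨hn0, hpos⟩ := Finset.mem_filter.1 hn
  refine ⟨idx_pos hidx n, (idx_le hidx hpos).trans ?_⟩
  exact (Finset.single_le_sum (fun i _ => Nat.zero_le ((f.eval ((i : ℕ) : ℤ)).toNat)) hn0 : _)

/-- Counting through the indices: `Σ_{v ≤ Xb, Q(v)} a_v = #{n ∈ S : d_T ∣ f(n), Q(idx n)}`. [folklore] -/
theorem A_sum_filter (hS : S = (Ioc 0 x).filter (fun n : ℕ => 0 < f.eval (n : ℤ)))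
    (hidx : ∀ n, idx n =
      ∏ p ∈ ((f.eval (n : ℤ)).toNat.primeFactors).filter (fun q => ¬ q ∣ 2 * ∏ p ∈ T, p), p)
    (ha : ∀ v, A.a v = #((S.filter (fun n : ℕ => (∏ p ∈ T, p) ∣ (f.eval (n : ℤ)).toNat)).filter
      (fun n : ℕ => idx n = v)))
    (hXb : Xb = ((∑ n ∈ Ioc 0 x, (f.eval (n : ℤ)).toNat : ℕ) : ℝ))
    (Q : ℕ → Prop) [DecidablePred Q] :
    ∑ v ∈ (Ioc 0 ⌊Xb⌋₊).filter Q, A.a v =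
      #((S.filter (fun n : ℕ => (∏ p ∈ T, p) ∣ (f.eval (n : ℤ)).toNat)).filter
        (fun n : ℕ => Q (idx n))) := by
  simp_rw [ha]
  rw [← Nat.cast_sum, Finset.sum_card_fiberwise_eq_card_filter]
  congr 2
  ext n
  simp only [Finset.mem_filter, and_congr_right_iff]
  intro hn
  exact ⟨fun h => h.2, fun h => ⟨idx_mem_Ioc hS hidx hXb hn.1, h⟩⟩

/-- The elementary count: `|#{n ∈ (0, x] : q ∣ f(n)} − x ρ(q)/q| ≤ ρ(q)`. [folklore] -/
theorem abs_card_dvd_sub_le (f : ℤ[X]) (x : ℕ) {q : ℕ} (hq : 0 < q) :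
    |(#((Ioc 0 x).filter fun n : ℕ => (q : ℤ) ∣ f.eval (n : ℤ)) : ℝ) -
        x * ((polyRootCountMod ![f] q : ℝ) / q)| ≤ polyRootCountMod ![f] q := by
  rw [card_filter_dvd_eval_eq_sum f _ hq, ← card_filter_dvd_eval_eq_polyRootCountMod f q]
  set R := (range q).filter (fun s : ℕ => (q : ℤ) ∣ f.eval (s : ℤ)) with hR
  have hrw : (x : ℝ) * ((#R : ℝ) / q) = ∑ _s ∈ R, (x : ℝ) / ((1 : ℕ) * q) := by
    rw [Finset.sum_const, nsmul_eq_mul]; push_cast; ring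
  rw [hrw, Nat.cast_sum, ← Finset.sum_sub_distrib]
  refine (Finset.abs_sum_le_sum_abs _ _).trans ?_
  calc ∑ s ∈ R, |((#((Ioc 0 x).filter fun n : ℕ => n ≡ s [MOD q]) : ℕ) : ℝ) - (x : ℝ) / ((1 : ℕ) * q)|
      ≤ ∑ _s ∈ R, (1 : ℝ) := Finset.sum_le_sum fun s _ => by
        have h := abs_card_apIndex_filter_modEq_sub_le (q := 1) Nat.one_pos hq (Nat.coprime_one_left q) x 0 s
        rwa [apIndex_one] at h
    _ = #R := by rw [Finset.sum_const, nsmul_eq_mul, mul_one]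

/-- The count restricted to `f(n) > 0` differs by at most `N₀` (if `f(n) > 0` for `n > N₀`). [folklore] -/
theorem card_S_filter_dvd_bounds (hS : S = (Ioc 0 x).filter (fun n : ℕ => 0 < f.eval (n : ℤ)))
    {N0 : ℕ} (hN0 : ∀ n : ℕ, N0 < n → 0 < f.eval (n : ℤ)) (q : ℕ) :
    #((Ioc 0 x).filter fun n : ℕ => (q : ℤ) ∣ f.eval (n : ℤ)) ≤
        #(S.filter fun n : ℕ => q ∣ (f.eval (n : ℤ)).toNat) + N0 ∧
      #(S.filter fun n : ℕ => q ∣ (f.eval (n : ℤ)).toNat) ≤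
        #((Ioc 0 x).filter fun n : ℕ => (q : ℤ) ∣ f.eval (n : ℤ)) := by
  subst hS
  have hsub : ((Ioc 0 x).filter (fun n : ℕ => 0 < f.eval (n : ℤ))).filter
      (fun n : ℕ => q ∣ (f.eval (n : ℤ)).toNat) ⊆
      (Ioc 0 x).filter fun n : ℕ => (q : ℤ) ∣ f.eval (n : ℤ) := by
    intro n hn
    simp only [Finset.mem_filter] at hn ⊢
    refine ⟨hn.1.1, ?_⟩
    have h := Int.natCast_dvd_natCast.2 hn.2
    rwa [Int.toNat_of_nonneg hn.1.2.le] at h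
  refine ⟨?_, Finset.card_le_card hsub⟩
  have hdiff : (Ioc 0 x).filter (fun n : ℕ => (q : ℤ) ∣ f.eval (n : ℤ)) ⊆
      ((Ioc 0 x).filter (fun n : ℕ => 0 < f.eval (n : ℤ))).filter
        (fun n : ℕ => q ∣ (f.eval (n : ℤ)).toNat) ∪ Ioc 0 N0 := by
    intro n hn
    simp only [Finset.mem_filter, Finset.mem_union, Finset.mem_Ioc] at hn ⊢
    by_cases hpos : 0 < f.eval (n : ℤ)
    · left
      refine ⟨⟨hn.1, hpos⟩, ?_⟩
      have h := hn.2
      rw [← Int.toNat_of_nonneg hpos.le] at h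
      exact Int.natCast_dvd_natCast.1 h
    · right
      refine ⟨hn.1.1, ?_⟩
      by_contra hlt
      exact hpos (hN0 n (not_le.1 hlt))
  calc #((Ioc 0 x).filter fun n : ℕ => (q : ℤ) ∣ f.eval (n : ℤ))
      ≤ #(((Ioc 0 x).filter (fun n : ℕ => 0 < f.eval (n : ℤ))).filter
          (fun n : ℕ => q ∣ (f.eval (n : ℤ)).toNat) ∪ Ioc 0 N0) := Finset.card_le_card hdiff
    _ ≤ _ := (Finset.card_union_le _ _).trans (by simp)

/-- **Remainder bound** for a pattern sequence: `|R_e| ≤ ρ(d_T) ρ(e) + N₀` for squarefree `e`. [folklore] -/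
theorem abs_remainder_A_le (hS : S = (Ioc 0 x).filter (fun n : ℕ => 0 < f.eval (n : ℤ)))
    (hidx : ∀ n, idx n =
      ∏ p ∈ ((f.eval (n : ℤ)).toNat.primeFactors).filter (fun q => ¬ q ∣ 2 * ∏ p ∈ T, p), p)
    (ha : ∀ v, A.a v = #((S.filter (fun n : ℕ => (∏ p ∈ T, p) ∣ (f.eval (n : ℤ)).toNat)).filter
      (fun n : ℕ => idx n = v)))
    (hsize : ∀ y, A.size y = x * rootDensity f (∏ p ∈ T, p))
    (hdens : ∀ m, A.density m = if m.Coprime (2 * ∏ p ∈ T, p) then rootDensity f m else 0)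
    (hXb : Xb = ((∑ n ∈ Ioc 0 x, (f.eval (n : ℤ)).toNat : ℕ) : ℝ))
    {N0 : ℕ} (hN0 : ∀ n : ℕ, N0 < n → 0 < f.eval (n : ℤ))
    (hT : ∀ p ∈ T, p.Prime) {e : ℕ} (he : Squarefree e) :
    |A.remainder e Xb| ≤
      (polyRootCountMod ![f] (∏ p ∈ T, p) : ℝ) * polyRootCountMod ![f] e + N0 := by
  rw [SieveSequence.remainder, SieveSequence.congrSum, A_sum_filter hS hidx ha hXb, hdens, hsize]
  have hd0 : 0 < ∏ p ∈ T, p := Finset.prod_pos fun p hp => (hT p hp).pos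
  by_cases hec : e.Coprime (2 * ∏ p ∈ T, p)
  · rw [if_pos hec]
    have he0 : 0 < e := Nat.pos_of_ne_zero he.ne_zero
    have hde : (∏ p ∈ T, p).Coprime e := Nat.Coprime.coprime_mul_left hec.symm
    have hset : (S.filter (fun n : ℕ => (∏ p ∈ T, p) ∣ (f.eval (n : ℤ)).toNat)).filter
        (fun n : ℕ => e ∣ idx n) =
        S.filter (fun n : ℕ => (∏ p ∈ T, p) * e ∣ (f.eval (n : ℤ)).toNat) := by
      ext n
      simp only [Finset.mem_filter, and_assoc]
      constructor
      · rintro ⟨hn, hd, hei⟩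
        have hpos : 0 < f.eval (n : ℤ) := by rw [hS] at hn; exact (Finset.mem_filter.1 hn).2
        exact ⟨hn, hde.mul_dvd_of_dvd_of_dvd hd ((dvd_idx_iff_of_coprime hidx he hec hpos).1 hei)⟩
      · rintro ⟨hn, hde'⟩
        have hpos : 0 < f.eval (n : ℤ) := by rw [hS] at hn; exact (Finset.mem_filter.1 hn).2
        exact ⟨hn, dvd_of_mul_right_dvd hde',
          (dvd_idx_iff_of_coprime hidx he hec hpos).2 (dvd_of_mul_left_dvd hde')⟩
    rw [hset]
    have hmult : rootDensity f e * ((x : ℝ) * rootDensity f (∏ p ∈ T, p)) =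
        (x : ℝ) * ((polyRootCountMod ![f] ((∏ p ∈ T, p) * e) : ℝ) / (((∏ p ∈ T, p) * e : ℕ) : ℝ)) := by
      rw [polyRootCountMod_mul_of_coprime f hde, rootDensity_apply, rootDensity_apply]
      push_cast
      have : (e : ℝ) ≠ 0 := by exact_mod_cast he0.ne'
      have : ((∏ p ∈ T, p : ℕ) : ℝ) ≠ 0 := by exact_mod_cast hd0.ne'
      field_simp
    rw [hmult]
    have h1 := abs_card_dvd_sub_le f x (q := (∏ p ∈ T, p) * e) (Nat.mul_pos hd0 he0)
    have h2 := card_S_filter_dvd_bounds hS hN0 ((∏ p ∈ T, p) * e)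
    have hρ : (polyRootCountMod ![f] ((∏ p ∈ T, p) * e) : ℝ) =
        (polyRootCountMod ![f] (∏ p ∈ T, p) : ℝ) * polyRootCountMod ![f] e := by
      rw [polyRootCountMod_mul_of_coprime f hde]; push_cast; ring
    rw [abs_le] at h1 ⊢
    have h2a : (#((Ioc 0 x).filter fun n : ℕ => ((((∏ p ∈ T, p) * e : ℕ)) : ℤ) ∣ f.eval (n : ℤ)) : ℝ) ≤
        #(S.filter fun n : ℕ => (∏ p ∈ T, p) * e ∣ (f.eval (n : ℤ)).toNat) + N0 := by
      exact_mod_cast h2.1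
    have h2b : (#(S.filter fun n : ℕ => (∏ p ∈ T, p) * e ∣ (f.eval (n : ℤ)).toNat) : ℝ) ≤
        #((Ioc 0 x).filter fun n : ℕ => ((((∏ p ∈ T, p) * e : ℕ)) : ℤ) ∣ f.eval (n : ℤ)) := by
      exact_mod_cast h2.2
    constructor <;> nlinarith [h1.1, h1.2, h2a, h2b, hρ]
  · rw [if_neg hec, zero_mul, sub_zero]
    have hempty : (S.filter (fun n : ℕ => (∏ p ∈ T, p) ∣ (f.eval (n : ℤ)).toNat)).filter
        (fun n : ℕ => e ∣ idx n) = ∅ :=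
      Finset.filter_false_of_mem fun n _ => not_dvd_idx_of_not_coprime hidx he hec n
    rw [hempty, Finset.card_empty, Nat.cast_zero, abs_zero]
    positivity

/-- **Sieve dimension**: the density of a pattern sequence satisfies `Ω(4)` with the constant
`K = 5⁵ e^{4(9/2 + 6/log 2)}` of the tree's `BoundedClassDensity.hasSieveDimension_of_card_le`,
uniformly in `T` (`ρ(p) ≤ 2 < p` for odd `p`, and the density vanishes at `2`). [folklore] -/
theorem hasSieveDimension_A
    (hdens : ∀ m, A.density m = if m.Coprime (2 * ∏ p ∈ T, p) then rootDensity f m else 0)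
    (hρ2 : ∀ p : ℕ, p.Prime → polyRootCountMod ![f] p ≤ 2) :
    HasSieveDimension A.density (2 * (2 : ℕ))
      (((2 * 2 + 1 : ℕ) : ℝ) ^ (2 * 2 + 1) * Real.exp (2 * (2 : ℕ) * (9 / 2 + 6 / Real.log 2))) := by
  classical
  refine BoundedClassDensity.hasSieveDimension_of_card_le
    (c := fun p => if p.Coprime (2 * ∏ p ∈ T, p) then polyRootCountMod ![f] p else 0) (D := 2)
    ?_ ?_ ?_
  · intro p _
    rw [hdens, rootDensity_apply]
    split_ifs <;> simp
  · intro p hp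
    split_ifs
    · exact hρ2 p hp
    · exact Nat.zero_le _
  · intro p hp
    split_ifs with hc
    · have hp2 : p ≠ 2 := by
        rintro rfl
        exact absurd (hc.eq_one_of_dvd (dvd_mul_right 2 _)) (by norm_num)
      have h3 : 2 < p := lt_of_le_of_ne hp.two_le (Ne.symm hp2)
      exact lt_of_le_of_lt (hρ2 p hp) h3
    · exact hp.pos

/-- `V(P(z)) = ∏_{p ∈ P ∖ T} (1 − ρ(p)/p)` for a pattern sequence (`T ⊆ P =` odd primes `< z`). [folklore] -/
theorem densityProduct_A (hP : P = (Nat.primesBelow ⌈z⌉₊).filter (fun p => 3 ≤ p))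
    (hdens : ∀ m, A.density m = if m.Coprime (2 * ∏ p ∈ T, p) then rootDensity f m else 0)
    (hTP : T ⊆ P) :
    A.densityProduct (primesProdBelow z) = ∏ p ∈ P \ T, (1 - rootDensity f p) := by
  rw [SieveSequence.densityProduct, primeFactors_primesProdBelow]
  have hT : ∀ p ∈ T, p.Prime := fun p hp => prime_of_mem_P hP (hTP hp)
  have hsub : P \ T ⊆ Nat.primesBelow ⌈z⌉₊ := fun p hp => by
    have := (Finset.mem_sdiff.1 hp).1
    rw [hP] at this
    exact (Finset.mem_filter.1 this).1
  have hone : ∀ p ∈ Nat.primesBelow ⌈z⌉₊, p ∉ P \ T → 1 - A.density p = 1 := by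
    intro p hp2 hp1
    have hpp := (Nat.mem_primesBelow.1 hp2).2
    rw [hdens, if_neg, sub_zero]
    rw [Nat.Prime.coprime_iff_not_dvd hpp, not_not]
    rw [Finset.mem_sdiff, not_and_or, not_not] at hp1
    rcases hp1 with hnO | hT'
    · have hlt : p < 3 := by
        by_contra h
        exact hnO ((mem_P hP).2 ⟨hpp, not_lt.1 h, (Nat.mem_primesBelow.1 hp2).1⟩)
      have hp2' : p = 2 := by have := hpp.two_le; omega
      subst hp2'
      exact dvd_mul_right 2 _
    · exact (Finset.dvd_prod_of_mem _ hT').mul_left 2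
  rw [← Finset.prod_subset hsub hone]
  refine Finset.prod_congr rfl fun p hp => ?_
  obtain ⟨hpO, hpT⟩ := Finset.mem_sdiff.1 hp
  obtain ⟨hpp, hp3, -⟩ := (mem_P hP).1 hpO
  rw [hdens, if_pos]
  rw [Nat.Prime.coprime_iff_not_dvd hpp]
  intro h
  rcases (Nat.Prime.dvd_mul hpp).1 h with h2 | hd
  · have := Nat.le_of_dvd two_pos h2; omega
  · exact hpT ((prime_dvd_prod_primes_iff hT hpp).1 hd)

/-- `X V(P(z)) = x M(T)`: the main term of the sieve is the model weight. [folklore] -/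
theorem size_mul_densityProduct (hP : P = (Nat.primesBelow ⌈z⌉₊).filter (fun p => 3 ≤ p))
    {M : Finset ℕ → ℝ}
    (hM : ∀ T, M T = (∏ p ∈ T, rootDensity f p) * ∏ p ∈ P \ T, (1 - rootDensity f p))
    (hsize : ∀ y, A.size y = x * rootDensity f (∏ p ∈ T, p))
    (hdens : ∀ m, A.density m = if m.Coprime (2 * ∏ p ∈ T, p) then rootDensity f m else 0)
    (hTP : T ⊆ P) (y : ℝ) :
    A.size y * A.densityProduct (primesProdBelow z) = (x : ℝ) * M T := by
  rw [densityProduct_A hP hdens hTP, hM, hsize,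
    (isMultiplicative_rootDensity f).map_prod_of_prime T fun p hp => prime_of_mem_P hP (hTP hp)]
  ring

/-- **The sifting function is the pattern count**: `S(𝒜_T, P(z)) = E_T`. [folklore] -/
theorem sifted_A_eq_E (hP : P = (Nat.primesBelow ⌈z⌉₊).filter (fun p => 3 ≤ p))
    (hpat : ∀ n, pat n = ((f.eval (n : ℤ)).toNat.primeFactors).filter (fun p => 3 ≤ p ∧ p < ⌈z⌉₊))
    (hS : S = (Ioc 0 x).filter (fun n : ℕ => 0 < f.eval (n : ℤ)))
    (hE : ∀ T, E T = #(S.filter (fun n => pat n = T)))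
    (hidx : ∀ n, idx n =
      ∏ p ∈ ((f.eval (n : ℤ)).toNat.primeFactors).filter (fun q => ¬ q ∣ 2 * ∏ p ∈ T, p), p)
    (ha : ∀ v, A.a v = #((S.filter (fun n : ℕ => (∏ p ∈ T, p) ∣ (f.eval (n : ℤ)).toNat)).filter
      (fun n : ℕ => idx n = v)))
    (hXb : Xb = ((∑ n ∈ Ioc 0 x, (f.eval (n : ℤ)).toNat : ℕ) : ℝ)) (hTP : T ⊆ P) :
    A.sifted Xb (primesProdBelow z) = E T := by
  rw [SieveSequence.sifted, A_sum_filter hS hidx ha hXb, hE]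
  refine congrArg (fun s : Finset ℕ => ((#s : ℕ) : ℝ)) ?_
  ext n
  simp only [Finset.mem_filter, and_assoc]
  refine and_congr_right fun hn => ?_
  have hpos : 0 < f.eval (n : ℤ) := by rw [hS] at hn; exact (Finset.mem_filter.1 hn).2
  set m := (f.eval (n : ℤ)).toNat with hm
  have hm0 : m ≠ 0 := by rw [hm, Ne, Int.toNat_eq_zero]; omega
  have hT : ∀ p ∈ T, p.Prime := fun p hp => prime_of_mem_P hP (hTP hp)
  rw [coprime_primesProdBelow_iff]
  have hidx' : ∀ q : ℕ, q.Prime → (q ∣ idx n ↔ q ∈ m.primeFactors ∧ ¬ q ∣ 2 * ∏ p ∈ T, p) := by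
    intro q hq
    rw [hidx, prime_dvd_prod_primes_iff (fun p hp =>
      Nat.prime_of_mem_primeFactors (Finset.mem_filter.1 hp).1) hq, Finset.mem_filter]
  constructor
  · rintro ⟨hd, hcop⟩
    rw [hpat]
    ext p
    rw [Finset.mem_filter]
    constructor
    · rintro ⟨hpm, hp3, hpz⟩
      have hpp := Nat.prime_of_mem_primeFactors hpm
      have h1 := hcop p (Nat.mem_primesBelow.2 ⟨hpz, hpp⟩)
      rw [hidx' p hpp] at h1
      have h2 : p ∣ 2 * ∏ p ∈ T, p := by by_contra h; exact h1 ⟨hpm, h⟩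
      rcases (Nat.Prime.dvd_mul hpp).1 h2 with h | h
      · have := Nat.le_of_dvd two_pos h; omega
      · exact (prime_dvd_prod_primes_iff hT hpp).1 h
    · intro hpT
      have hpO := (mem_P hP).1 (hTP hpT)
      exact ⟨(prod_primes_dvd_iff hT hm0).1 hd hpT, hpO.2.1, hpO.2.2⟩
  · intro hpatT
    rw [hpat] at hpatT
    have hTsub : T ⊆ m.primeFactors := by
      rw [← hpatT]; exact Finset.filter_subset _ _
    refine ⟨(prod_primes_dvd_iff hT hm0).2 hTsub, fun q hq => ?_⟩
    obtain ⟨hqz, hqp⟩ := Nat.mem_primesBelow.1 hq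
    rw [hidx' q hqp, not_and, not_not]
    intro hqm
    by_cases hq3 : 3 ≤ q
    · have hmem : q ∈ m.primeFactors.filter (fun p => 3 ≤ p ∧ p < ⌈z⌉₊) :=
        Finset.mem_filter.2 ⟨hqm, hq3, hqz⟩
      rw [hpatT] at hmem
      exact (Finset.dvd_prod_of_mem _ hmem).mul_left 2
    · have h2 : q = 2 := by have := hqp.two_le; omega
      subst h2
      exact dvd_mul_right 2 _

/-- The tree's PROVED uniform Fundamental Lemma (`SieveSequence.fundamental_lemma_uniform_holds`)
in dimension `4` with the constant of `hasSieveDimension_A`: there is `C > 0` with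
`|S(𝒜, z) − X V(z)| ≤ C X V(z) e^{−log D/log z} + Σ_{d ∣ P(z), d ≤ D} |R_d|` for every such `𝒜`. [folklore] -/
theorem exists_FL_const : ∃ C : ℝ, 0 < C ∧ ∀ A : SieveSequence,
    HasSieveDimension A.density (2 * (2 : ℕ))
      (((2 * 2 + 1 : ℕ) : ℝ) ^ (2 * 2 + 1) * Real.exp (2 * (2 : ℕ) * (9 / 2 + 6 / Real.log 2))) →
    ∀ x z D : ℝ, 2 ≤ z → z ≤ D → 0 ≤ A.size x →
      |A.sifted x (primesProdBelow z) - A.size x * A.densityProduct (primesProdBelow z)| ≤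
        C * A.size x * A.densityProduct (primesProdBelow z) *
            Real.exp (-(Real.log D / Real.log z)) +
          ∑ d ∈ (primesProdBelow z).divisors.filter (fun d : ℕ => (d : ℝ) ≤ D), |A.remainder d x| :=
  SieveSequence.fundamental_lemma_uniform_holds _ _

/-- **The Kubilius comparison for one pattern** (the pattern sequence written down and fed to the
Fundamental Lemma with constant `C`):
`|E_T − x M(T)| ≤ C x M(T) e^{−log D/log z} + ρ(d_T) D e⁸ log² z + N₀ D`. [folklore] -/
theorem abs_E_sub_le (hP : P = (Nat.primesBelow ⌈z⌉₊).filter (fun p => 3 ≤ p))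
    (hpat : ∀ n, pat n = ((f.eval (n : ℤ)).toNat.primeFactors).filter (fun p => 3 ≤ p ∧ p < ⌈z⌉₊))
    (hS : S = (Ioc 0 x).filter (fun n : ℕ => 0 < f.eval (n : ℤ)))
    (hE : ∀ T, E T = #(S.filter (fun n => pat n = T))) {M : Finset ℕ → ℝ}
    (hM : ∀ T, M T = (∏ p ∈ T, rootDensity f p) * ∏ p ∈ P \ T, (1 - rootDensity f p))
    {C : ℝ} (hFL : ∀ A : SieveSequence,
      HasSieveDimension A.density (2 * (2 : ℕ))
        (((2 * 2 + 1 : ℕ) : ℝ) ^ (2 * 2 + 1) * Real.exp (2 * (2 : ℕ) * (9 / 2 + 6 / Real.log 2))) →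
      ∀ x z D : ℝ, 2 ≤ z → z ≤ D → 0 ≤ A.size x →
        |A.sifted x (primesProdBelow z) - A.size x * A.densityProduct (primesProdBelow z)| ≤
          C * A.size x * A.densityProduct (primesProdBelow z) *
              Real.exp (-(Real.log D / Real.log z)) +
            ∑ d ∈ (primesProdBelow z).divisors.filter (fun d : ℕ => (d : ℝ) ≤ D), |A.remainder d x|)
    (hρ2 : ∀ p : ℕ, p.Prime → polyRootCountMod ![f] p ≤ 2)
    {N0 : ℕ} (hN0 : ∀ n : ℕ, N0 < n → 0 < f.eval (n : ℤ)) {D : ℝ} (hz : 2 ≤ z) (hzD : z ≤ D)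
    (hTP : T ⊆ P) :
    |(E T : ℝ) - x * M T| ≤
      C * ((x : ℝ) * M T) * Real.exp (-(Real.log D / Real.log z)) +
        ((polyRootCountMod ![f] (∏ p ∈ T, p) : ℝ) * (D * (Real.exp 8 * Real.log z ^ 2)) + N0 * D) := by
  classical
  have hT : ∀ p ∈ T, p.Prime := fun p hp => prime_of_mem_P hP (hTP hp)
  -- the pattern sequence, written down
  let idx : ℕ → ℕ := fun n =>
    ∏ p ∈ ((f.eval (n : ℤ)).toNat.primeFactors).filter (fun q => ¬ q ∣ 2 * ∏ p ∈ T, p), p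
  let g' : ArithmeticFunction ℝ :=
    ⟨fun m => if m.Coprime (2 * ∏ p ∈ T, p) then rootDensity f m else 0,
      by simp only [ArithmeticFunction.map_zero, ite_self]⟩
  have hg' : ∀ m, g' m = if m.Coprime (2 * ∏ p ∈ T, p) then rootDensity f m else 0 := fun _ => rfl
  let A : SieveSequence :=
    { a := fun v => ((#((S.filter (fun n : ℕ => (∏ p ∈ T, p) ∣ (f.eval (n : ℤ)).toNat)).filter
        (fun n : ℕ => idx n = v)) : ℕ) : ℝ)
      a_nonneg := fun _ => Nat.cast_nonneg _
      size := fun _ => (x : ℝ) * rootDensity f (∏ p ∈ T, p)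
      density := g'
      density_mult := isMultiplicative_of_restrict (isMultiplicative_rootDensity f) _ hg' }
  have hidx : ∀ n, idx n =
      ∏ p ∈ ((f.eval (n : ℤ)).toNat.primeFactors).filter (fun q => ¬ q ∣ 2 * ∏ p ∈ T, p), p :=
    fun _ => rfl
  have ha : ∀ v, A.a v = #((S.filter (fun n : ℕ => (∏ p ∈ T, p) ∣ (f.eval (n : ℤ)).toNat)).filter
      (fun n : ℕ => idx n = v)) := fun _ => rfl
  have hsize : ∀ y, A.size y = x * rootDensity f (∏ p ∈ T, p) := fun _ => rfl
  have hdens : ∀ m, A.density m = if m.Coprime (2 * ∏ p ∈ T, p) then rootDensity f m else 0 :=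
    fun _ => rfl
  set Xb : ℝ := ((∑ n ∈ Ioc 0 x, (f.eval (n : ℤ)).toNat : ℕ) : ℝ) with hXb
  have hsz : 0 ≤ A.size Xb := by
    rw [hsize]; exact mul_nonneg (Nat.cast_nonneg _) (rootDensity_nonneg f _)
  have h := hFL A (hasSieveDimension_A hdens hρ2) Xb z D hz hzD hsz
  rw [sifted_A_eq_E hP hpat hS hE hidx ha hXb hTP, mul_assoc C,
    size_mul_densityProduct hP hM hsize hdens hTP] at h
  refine h.trans (add_le_add le_rfl ?_)
  have hD : 0 ≤ D := by linarith
  calc ∑ e ∈ (primesProdBelow z).divisors.filter (fun e : ℕ => (e : ℝ) ≤ D), |A.remainder e Xb|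
      ≤ ∑ e ∈ (primesProdBelow z).divisors.filter (fun e : ℕ => (e : ℝ) ≤ D),
          ((polyRootCountMod ![f] (∏ p ∈ T, p) : ℝ) * polyRootCountMod ![f] e + N0) :=
        Finset.sum_le_sum fun e he => abs_remainder_A_le hS hidx ha hsize hdens hXb hN0 hT
          (Squarefree.squarefree_of_dvd (Nat.dvd_of_mem_divisors (Finset.mem_filter.1 he).1)
            (squarefree_primesProdBelow z))
    _ = (polyRootCountMod ![f] (∏ p ∈ T, p) : ℝ) *
            ∑ e ∈ (primesProdBelow z).divisors.filter (fun e : ℕ => (e : ℝ) ≤ D),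
              (polyRootCountMod ![f] e : ℝ) +
          N0 * #((primesProdBelow z).divisors.filter (fun e : ℕ => (e : ℝ) ≤ D)) := by
        rw [Finset.sum_add_distrib, Finset.mul_sum, Finset.sum_const, nsmul_eq_mul]; ring
    _ ≤ (polyRootCountMod ![f] (∏ p ∈ T, p) : ℝ) * (D * (Real.exp 8 * Real.log z ^ 2)) + N0 * D :=
        add_le_add (mul_le_mul_of_nonneg_left (sum_rootCount_divisors_le hρ2 hz hD) (Nat.cast_nonneg _))
          (mul_le_mul_of_nonneg_left (BFI.card_divisors_filter_le _ hD) (Nat.cast_nonneg _))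

end SeqA

/-! ### E. Total variation between reality and the model; the bound for one cell -/

section Assembly

variable {f : ℤ[X]} {x : ℕ} {z : ℝ} {P : Finset ℕ} {pat : ℕ → Finset ℕ} {S : Finset ℕ}
  {E : Finset ℕ → ℕ}

/-- There are at most `Y` patterns `T` with `d_T ≤ Y`. [folklore] -/
theorem card_filter_dT_le (hP : P = (Nat.primesBelow ⌈z⌉₊).filter (fun p => 3 ≤ p)) {Y : ℝ}
    (hY : 0 ≤ Y) :
    (#(P.powerset.filter (fun T => (((∏ p ∈ T, p : ℕ)) : ℝ) ≤ Y)) : ℝ) ≤ Y := by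
  have hp : ∀ T ∈ P.powerset.filter (fun T => (((∏ p ∈ T, p : ℕ)) : ℝ) ≤ Y),
      ∀ p ∈ T, p.Prime := fun T hT p hp =>
    prime_of_mem_P hP (Finset.mem_powerset.1 (Finset.mem_filter.1 hT).1 hp)
  have hinj : Set.InjOn (fun T : Finset ℕ => ∏ p ∈ T, p) (P.powerset.filter (fun T => (((∏ p ∈ T, p : ℕ)) : ℝ) ≤ Y)) := by
    intro T₁ h₁ T₂ h₂ heq
    rw [← Nat.primeFactors_prod (hp T₁ h₁), ← Nat.primeFactors_prod (hp T₂ h₂)]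
    exact congrArg Nat.primeFactors (by simpa using heq)
  have hmaps : ∀ T ∈ P.powerset.filter (fun T => (((∏ p ∈ T, p : ℕ)) : ℝ) ≤ Y),
      (∏ p ∈ T, p) ∈ Icc 1 ⌊Y⌋₊ := by
    intro T hT
    rw [Finset.mem_Icc]
    exact ⟨Finset.prod_pos fun p hpT => (hp T hT p hpT).pos, Nat.le_floor (Finset.mem_filter.1 hT).2⟩
  calc (#(P.powerset.filter (fun T => (((∏ p ∈ T, p : ℕ)) : ℝ) ≤ Y)) : ℝ)
      ≤ #(Icc 1 ⌊Y⌋₊) := by exact_mod_cast Finset.card_le_card_of_injOn (fun T : Finset ℕ => ∏ p ∈ T, p) hmaps hinj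
    _ = ⌊Y⌋₊ := by rw [Nat.card_Icc, Nat.add_sub_cancel]
    _ ≤ Y := Nat.floor_le hY

/-- **The cell bound.** For `2 ≤ z ≤ D`, `Y > 0` and a positive model variance, every cell
`#{n ≤ x : f(n) > 0, |pat(n)| = i}` is at most
`x (√(π/8σ²) + Y^{−1/log⌊z⌋} e^{2(e−1)(1 + log 4/log⌊z⌋)}) + 2 (C x e^{−log D/log z} + Y (Y D e⁸ log² z + N₀ D))`
(`C` the constant of the Fundamental Lemma). [folklore] -/
theorem cell_le (hP : P = (Nat.primesBelow ⌈z⌉₊).filter (fun p => 3 ≤ p))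
    (hpat : ∀ n, pat n = ((f.eval (n : ℤ)).toNat.primeFactors).filter (fun p => 3 ≤ p ∧ p < ⌈z⌉₊))
    (hS : S = (Ioc 0 x).filter (fun n : ℕ => 0 < f.eval (n : ℤ)))
    (hE : ∀ T, E T = #(S.filter (fun n => pat n = T))) {M : Finset ℕ → ℝ}
    (hM : ∀ T, M T = (∏ p ∈ T, rootDensity f p) * ∏ p ∈ P \ T, (1 - rootDensity f p))
    {C : ℝ} (hC : 0 ≤ C) (hFL : ∀ A : SieveSequence,
      HasSieveDimension A.density (2 * (2 : ℕ))
        (((2 * 2 + 1 : ℕ) : ℝ) ^ (2 * 2 + 1) * Real.exp (2 * (2 : ℕ) * (9 / 2 + 6 / Real.log 2))) →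
      ∀ x z D : ℝ, 2 ≤ z → z ≤ D → 0 ≤ A.size x →
        |A.sifted x (primesProdBelow z) - A.size x * A.densityProduct (primesProdBelow z)| ≤
          C * A.size x * A.densityProduct (primesProdBelow z) *
              Real.exp (-(Real.log D / Real.log z)) +
            ∑ d ∈ (primesProdBelow z).divisors.filter (fun d : ℕ => (d : ℝ) ≤ D), |A.remainder d x|)
    (hρ2 : ∀ p : ℕ, p.Prime → polyRootCountMod ![f] p ≤ 2)
    {N0 : ℕ} (hN0 : ∀ n : ℕ, N0 < n → 0 < f.eval (n : ℤ)) {D Y : ℝ} (hz : 2 ≤ z) (hzD : z ≤ D)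
    (hY : 0 < Y) (hvar : 0 < ∑ p ∈ P, rootDensity f p * (1 - rootDensity f p)) (i : ℕ) :
    (#(S.filter (fun n : ℕ => (pat n).card = i)) : ℝ) ≤
      x * (Real.sqrt (π / (8 * ∑ p ∈ P, rootDensity f p * (1 - rootDensity f p))) +
          Y ^ (-(1 / Real.log ⌊z⌋₊)) *
            Real.exp (2 * (Real.exp 1 - 1) / Real.log ⌊z⌋₊ * (Real.log ⌊z⌋₊ + Real.log 4))) +
        2 * (C * x * Real.exp (-(Real.log D / Real.log z)) +
          Y * (Y * (D * (Real.exp 8 * Real.log z ^ 2)) + N0 * D)) := by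
  -- basic facts on the model parameters
  have hg0 : ∀ p ∈ P, 0 ≤ rootDensity f p := fun p _ => rootDensity_nonneg f p
  have hg1 : ∀ p ∈ P, rootDensity f p ≤ 1 := fun p _ => rootDensity_le_one f p
  have hg2 : ∀ p ∈ P, rootDensity f p ≤ 2 / p := fun p hp => by
    rw [rootDensity_apply]
    exact div_le_div_of_nonneg_right (by exact_mod_cast hρ2 p (prime_of_mem_P hP hp))
      (Nat.cast_nonneg _)
  have hM0 : ∀ T ∈ P.powerset, 0 ≤ M T := fun T hT =>
    M_nonneg hM hg0 hg1 (Finset.mem_powerset.1 hT)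
  have hD : 0 ≤ D := by linarith
  have hx : (0 : ℝ) ≤ x := Nat.cast_nonneg x
  have hR₁ : 0 ≤ Y * (D * (Real.exp 8 * Real.log z ^ 2)) + N0 * D := by positivity
  -- (1) the comparison on the patterns with `d_T ≤ Y`, summed
  have hsumA : ∑ T ∈ P.powerset.filter (fun T => (((∏ p ∈ T, p : ℕ)) : ℝ) ≤ Y),
      |(E T : ℝ) - x * M T| ≤
        C * x * Real.exp (-(Real.log D / Real.log z)) +
          Y * (Y * (D * (Real.exp 8 * Real.log z ^ 2)) + N0 * D) := by
    have hAT : ∀ T ∈ P.powerset.filter (fun T => (((∏ p ∈ T, p : ℕ)) : ℝ) ≤ Y),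
        |(E T : ℝ) - x * M T| ≤
          C * x * Real.exp (-(Real.log D / Real.log z)) * M T +
            (Y * (D * (Real.exp 8 * Real.log z ^ 2)) + N0 * D) := by
      intro T hT
      obtain ⟨hTP, hTg⟩ := Finset.mem_filter.1 hT
      have h := abs_E_sub_le hP hpat hS hE hM hFL hρ2 hN0 hz hzD (Finset.mem_powerset.1 hTP)
      have hρd : (polyRootCountMod ![f] (∏ p ∈ T, p) : ℝ) ≤ Y := (Nat.cast_le.2 (polyRootCountMod_le_self f _)).trans hTg
      have hDlog : 0 ≤ D * (Real.exp 8 * Real.log z ^ 2) := by positivity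
      have h3 : (polyRootCountMod ![f] (∏ p ∈ T, p) : ℝ) * (D * (Real.exp 8 * Real.log z ^ 2)) ≤
          Y * (D * (Real.exp 8 * Real.log z ^ 2)) := mul_le_mul_of_nonneg_right hρd hDlog
      refine h.trans ?_
      have : C * ((x : ℝ) * M T) * Real.exp (-(Real.log D / Real.log z)) =
          C * x * Real.exp (-(Real.log D / Real.log z)) * M T := by ring
      rw [this]
      linarith
    calc ∑ T ∈ P.powerset.filter (fun T => (((∏ p ∈ T, p : ℕ)) : ℝ) ≤ Y),
          |(E T : ℝ) - x * M T|
        ≤ ∑ T ∈ P.powerset.filter (fun T => (((∏ p ∈ T, p : ℕ)) : ℝ) ≤ Y),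
            (C * x * Real.exp (-(Real.log D / Real.log z)) * M T +
              (Y * (D * (Real.exp 8 * Real.log z ^ 2)) + N0 * D)) := Finset.sum_le_sum hAT
      _ = C * x * Real.exp (-(Real.log D / Real.log z)) *
              ∑ T ∈ P.powerset.filter (fun T => (((∏ p ∈ T, p : ℕ)) : ℝ) ≤ Y),
                M T +
            #(P.powerset.filter (fun T => (((∏ p ∈ T, p : ℕ)) : ℝ) ≤ Y)) *
              (Y * (D * (Real.exp 8 * Real.log z ^ 2)) + N0 * D) := by
          rw [Finset.sum_add_distrib, Finset.sum_const, nsmul_eq_mul, Finset.mul_sum]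
      _ ≤ C * x * Real.exp (-(Real.log D / Real.log z)) * 1 +
            Y * (Y * (D * (Real.exp 8 * Real.log z ^ 2)) + N0 * D) := by
          have h1 : ∑ T ∈ P.powerset.filter (fun T => (((∏ p ∈ T, p : ℕ)) : ℝ) ≤ Y),
              M T ≤ 1 := by
            rw [← sum_M_eq_one hM]
            exact Finset.sum_le_sum_of_subset_of_nonneg (Finset.filter_subset _ _)
              fun T hT _ => hM0 T hT
          have h2 := card_filter_dT_le hP hY.le
          have hε0 : 0 ≤ C * x * Real.exp (-(Real.log D / Real.log z)) := by positivity
          exact add_le_add (mul_le_mul_of_nonneg_left h1 hε0) (mul_le_mul_of_nonneg_right h2 hR₁)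
      _ = _ := by ring
  -- (2) the patterns with `d_T > Y`: reality
  have hsplitE := Finset.sum_filter_add_sum_filter_not P.powerset
    (fun T => (((∏ p ∈ T, p : ℕ)) : ℝ) ≤ Y) (fun T => (E T : ℝ))
  have hsplitM := Finset.sum_filter_add_sum_filter_not P.powerset
    (fun T => (((∏ p ∈ T, p : ℕ)) : ℝ) ≤ Y) (fun T => M T)
  rw [sum_M_eq_one hM] at hsplitM
  have htot : ∑ T ∈ P.powerset, (E T : ℝ) ≤ x := by
    have h := sum_E_eq hP hpat hE
    calc ∑ T ∈ P.powerset, (E T : ℝ)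
        = ((∑ T ∈ P.powerset, E T : ℕ) : ℝ) := by push_cast; rfl
      _ ≤ x := by rw [h]; exact_mod_cast card_S_le hS
  have hgoodE : x * ∑ T ∈ P.powerset.filter (fun T => (((∏ p ∈ T, p : ℕ)) : ℝ) ≤ Y),
        M T -
      ∑ T ∈ P.powerset.filter (fun T => (((∏ p ∈ T, p : ℕ)) : ℝ) ≤ Y),
        |(E T : ℝ) - x * M T| ≤
      ∑ T ∈ P.powerset.filter (fun T => (((∏ p ∈ T, p : ℕ)) : ℝ) ≤ Y), (E T : ℝ) := by
    rw [Finset.mul_sum, ← Finset.sum_sub_distrib]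
    refine Finset.sum_le_sum fun T _ => ?_
    have h := le_abs_self ((x : ℝ) * M T - (E T : ℝ))
    rw [abs_sub_comm] at h
    linarith
  have hbadE : ∑ T ∈ P.powerset.filter (fun T => ¬ (((∏ p ∈ T, p : ℕ)) : ℝ) ≤ Y),
      (E T : ℝ) ≤
      x * ∑ T ∈ P.powerset.filter (fun T => ¬ (((∏ p ∈ T, p : ℕ)) : ℝ) ≤ Y),
          M T +
        ∑ T ∈ P.powerset.filter (fun T => (((∏ p ∈ T, p : ℕ)) : ℝ) ≤ Y),
          |(E T : ℝ) - x * M T| := by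
    have hxM : (x : ℝ) * ∑ T ∈ P.powerset.filter (fun T => ¬ (((∏ p ∈ T, p : ℕ)) : ℝ) ≤ Y),
        M T =
        x - x * ∑ T ∈ P.powerset.filter (fun T => (((∏ p ∈ T, p : ℕ)) : ℝ) ≤ Y),
          M T := by
      linear_combination (x : ℝ) * hsplitM
    linarith
  -- (3) the patterns with `d_T > Y`: model (Rankin)
  have hbadM : ∑ T ∈ P.powerset.filter (fun T => ¬ (((∏ p ∈ T, p : ℕ)) : ℝ) ≤ Y),
      M T ≤
      Y ^ (-(1 / Real.log ⌊z⌋₊)) *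
        Real.exp (2 * (Real.exp 1 - 1) / Real.log ⌊z⌋₊ * (Real.log ⌊z⌋₊ + Real.log 4)) := by
    have hPsub : P ⊆ Nat.primesLE ⌊z⌋₊ := fun p hp => by
      obtain ⟨hpp, -, hpz⟩ := (mem_P hP).1 hp
      exact Nat.mem_primesLE.2 ⟨Nat.le_floor (le_of_lt (Nat.lt_ceil.1 hpz)), hpp⟩
    have hN : 2 ≤ ⌊z⌋₊ := Nat.le_floor (by exact_mod_cast hz)
    have h := rankin_tail_le hM hg0 hg1 hg2 hN hPsub hY
    refine le_of_eq_of_le ?_ h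
    refine Finset.sum_congr (Finset.filter_congr fun T _ => ?_) fun _ _ => rfl
    exact not_le
  -- (4) the cell
  have hcell := card_filter_card_pat_eq hP hpat hE i
  have hsub1 : (P.powerset.filter (fun T => T.card = i)).filter
      (fun T => (((∏ p ∈ T, p : ℕ)) : ℝ) ≤ Y) ⊆
      P.powerset.filter (fun T => (((∏ p ∈ T, p : ℕ)) : ℝ) ≤ Y) := fun T hT =>
    Finset.mem_filter.2 ⟨(Finset.mem_filter.1 (Finset.mem_filter.1 hT).1).1, (Finset.mem_filter.1 hT).2⟩
  have hsub2 : (P.powerset.filter (fun T => T.card = i)).filter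
      (fun T => ¬ (((∏ p ∈ T, p : ℕ)) : ℝ) ≤ Y) ⊆
      P.powerset.filter (fun T => ¬ (((∏ p ∈ T, p : ℕ)) : ℝ) ≤ Y) := fun T hT =>
    Finset.mem_filter.2 ⟨(Finset.mem_filter.1 (Finset.mem_filter.1 hT).1).1, (Finset.mem_filter.1 hT).2⟩
  have h5a : ∑ T ∈ (P.powerset.filter (fun T => T.card = i)).filter
      (fun T => (((∏ p ∈ T, p : ℕ)) : ℝ) ≤ Y), (E T : ℝ) ≤
      x * ∑ T ∈ P.powerset with T.card = i, M T +
        ∑ T ∈ P.powerset.filter (fun T => (((∏ p ∈ T, p : ℕ)) : ℝ) ≤ Y),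
          |(E T : ℝ) - x * M T| := by
    calc ∑ T ∈ (P.powerset.filter (fun T => T.card = i)).filter
          (fun T => (((∏ p ∈ T, p : ℕ)) : ℝ) ≤ Y), (E T : ℝ)
        ≤ ∑ T ∈ (P.powerset.filter (fun T => T.card = i)).filter
            (fun T => (((∏ p ∈ T, p : ℕ)) : ℝ) ≤ Y),
            (x * M T + |(E T : ℝ) - x * M T|) := by
          refine Finset.sum_le_sum fun T _ => ?_
          have h := le_abs_self ((E T : ℝ) - x * M T)
          linarith
      _ = x * ∑ T ∈ (P.powerset.filter (fun T => T.card = i)).filter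
              (fun T => (((∏ p ∈ T, p : ℕ)) : ℝ) ≤ Y), M T +
            ∑ T ∈ (P.powerset.filter (fun T => T.card = i)).filter
              (fun T => (((∏ p ∈ T, p : ℕ)) : ℝ) ≤ Y),
              |(E T : ℝ) - x * M T| := by
          rw [Finset.sum_add_distrib, Finset.mul_sum]
      _ ≤ _ := by
          refine add_le_add (mul_le_mul_of_nonneg_left ?_ hx)
            (Finset.sum_le_sum_of_subset_of_nonneg hsub1 fun _ _ _ => abs_nonneg _)
          exact Finset.sum_le_sum_of_subset_of_nonneg (Finset.filter_subset _ _)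
            fun T hT _ => hM0 T (Finset.mem_filter.1 hT).1
  have h5b : ∑ T ∈ (P.powerset.filter (fun T => T.card = i)).filter
      (fun T => ¬ (((∏ p ∈ T, p : ℕ)) : ℝ) ≤ Y), (E T : ℝ) ≤
      ∑ T ∈ P.powerset.filter (fun T => ¬ (((∏ p ∈ T, p : ℕ)) : ℝ) ≤ Y), (E T : ℝ) :=
    Finset.sum_le_sum_of_subset_of_nonneg hsub2 fun _ _ _ => Nat.cast_nonneg _
  have hatom := atom_le hM hg0 hg1 hvar i
  have hτ0 : 0 ≤ Y ^ (-(1 / Real.log ⌊z⌋₊)) *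
      Real.exp (2 * (Real.exp 1 - 1) / Real.log ⌊z⌋₊ * (Real.log ⌊z⌋₊ + Real.log 4)) := by positivity
  calc (#(S.filter (fun n : ℕ => (pat n).card = i)) : ℝ)
      = ∑ T ∈ P.powerset.filter (fun T => T.card = i), (E T : ℝ) := by
        rw [hcell]; push_cast; rfl
    _ = ∑ T ∈ (P.powerset.filter (fun T => T.card = i)).filter
            (fun T => (((∏ p ∈ T, p : ℕ)) : ℝ) ≤ Y), (E T : ℝ) +
          ∑ T ∈ (P.powerset.filter (fun T => T.card = i)).filter
            (fun T => ¬ (((∏ p ∈ T, p : ℕ)) : ℝ) ≤ Y), (E T : ℝ) :=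
        (Finset.sum_filter_add_sum_filter_not _ _ _).symm
    _ ≤ x * ∑ T ∈ P.powerset with T.card = i, M T +
          ∑ T ∈ P.powerset.filter (fun T => (((∏ p ∈ T, p : ℕ)) : ℝ) ≤ Y),
            |(E T : ℝ) - x * M T| +
        (x * ∑ T ∈ P.powerset.filter (fun T => ¬ (((∏ p ∈ T, p : ℕ)) : ℝ) ≤ Y),
            M T +
          ∑ T ∈ P.powerset.filter (fun T => (((∏ p ∈ T, p : ℕ)) : ℝ) ≤ Y),
            |(E T : ℝ) - x * M T|) :=
        add_le_add h5a (h5b.trans hbadE)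
    _ ≤ _ := by
        have h6 : x * ∑ T ∈ P.powerset with T.card = i, M T ≤
            x * Real.sqrt (π / (8 * ∑ p ∈ P, rootDensity f p * (1 - rootDensity f p))) :=
          mul_le_mul_of_nonneg_left hatom hx
        have h7 := mul_le_mul_of_nonneg_left hbadM hx
        nlinarith [h6, h7, hsumA]

end Assembly

/-! ### F. From cells to `ω`, the inputs attached to `f`, and the choice of parameters -/

section Final

variable {f : ℤ[X]} {x : ℕ} {z : ℝ} {pat : ℕ → Finset ℕ} {S : Finset ℕ}

/-- **Cells to `ω`.** If every value `f(n) ≤ x`-range value is `< z^{L+1}` then `f(n)` has at most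
`L` prime factors `≥ z`, so `#pat(n) ≤ ω(f(n)) ≤ #pat(n) + L + 1`, and a bound `B` for every cell
`#{n : |pat(n)| = i}` bounds `#{n : ω(f(n)) = j}` by `(L + 2) B`. [folklore] -/
theorem card_omega_le
    (hpat : ∀ n, pat n = ((f.eval (n : ℤ)).toNat.primeFactors).filter (fun p => 3 ≤ p ∧ p < ⌈z⌉₊))
    (hS : S = (Ioc 0 x).filter (fun n : ℕ => 0 < f.eval (n : ℤ))) (hz1 : 1 < z) {L : ℕ}
    (hval : ∀ n ∈ S, (((f.eval (n : ℤ)).toNat : ℕ) : ℝ) < z ^ (L + 1)) {B : ℝ}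
    (hB : ∀ i : ℕ, (#(S.filter (fun n : ℕ => (pat n).card = i)) : ℝ) ≤ B) (j : ℕ) :
    (#(S.filter (fun n : ℕ =>
        ArithmeticFunction.cardDistinctFactors (f.eval (n : ℤ)).toNat = j)) : ℝ) ≤ (L + 2) * B := by
  have hB0 : 0 ≤ B := le_trans (Nat.cast_nonneg _) (hB 0)
  -- each `n` with `ω = j` lies in a cell `j - r`, `r < L + 2`
  have hsub : S.filter (fun n : ℕ =>
      ArithmeticFunction.cardDistinctFactors (f.eval (n : ℤ)).toNat = j) ⊆
      (Finset.range (L + 2)).biUnion (fun r =>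
        S.filter (fun n : ℕ => (pat n).card = j - r)) := by
    intro n hn
    obtain ⟨hnS, hω⟩ := Finset.mem_filter.1 hn
    have hpos : 0 < f.eval (n : ℤ) := by rw [hS] at hnS; exact (Finset.mem_filter.1 hnS).2
    set m := (f.eval (n : ℤ)).toNat with hm
    have hm0 : m ≠ 0 := by rw [hm, Ne, Int.toNat_eq_zero]; omega
    rw [ArithmeticFunction.cardDistinctFactors_apply, ← List.card_toFinset, Nat.toFinset_factors] at hω
    have hpatn : pat n = m.primeFactors.filter (fun p => 3 ≤ p ∧ p < ⌈z⌉₊) := by rw [hpat]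
    -- the large prime factors
    set U := m.primeFactors.filter (fun p => ⌈z⌉₊ ≤ p) with hU
    have hSp : ∀ p ∈ U, p.Prime := fun p hp => Nat.prime_of_mem_primeFactors (Finset.mem_filter.1 hp).1
    have hSL : U.card ≤ L := by
      have h1 : (⌈z⌉₊) ^ U.card ≤ ∏ p ∈ U, p :=
        Finset.pow_card_le_prod U (fun p => p) ⌈z⌉₊ fun p hp => (Finset.mem_filter.1 hp).2
      have h2 : ∏ p ∈ U, p ≤ m :=
        Nat.le_of_dvd (Nat.pos_of_ne_zero hm0)
          ((prod_primes_dvd_iff hSp hm0).2 (Finset.filter_subset _ _))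
      have h3 : z ^ U.card ≤ (m : ℝ) := by
        calc z ^ U.card ≤ ((⌈z⌉₊ : ℕ) : ℝ) ^ U.card :=
              pow_le_pow_left₀ (by linarith) (Nat.le_ceil z) _
          _ ≤ m := by exact_mod_cast h1.trans h2
      have h4 : z ^ U.card < z ^ (L + 1) := h3.trans_lt (hval n hnS)
      have := (pow_lt_pow_iff_right₀ hz1).1 h4
      omega
    -- `primeFactors m ⊆ {2} ∪ pat ∪ S`
    have hcover : m.primeFactors ⊆ insert 2 (pat n ∪ U) := by
      intro p hp
      have hpp := Nat.prime_of_mem_primeFactors hp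
      rw [Finset.mem_insert, Finset.mem_union]
      by_cases hp2 : p = 2
      · exact Or.inl hp2
      · right
        have hp3 : 3 ≤ p := by have := hpp.two_le; omega
        by_cases hpz : p < ⌈z⌉₊
        · exact Or.inl (hpatn ▸ Finset.mem_filter.2 ⟨hp, hp3, hpz⟩)
        · exact Or.inr (Finset.mem_filter.2 ⟨hp, not_lt.1 hpz⟩)
    have hcard : m.primeFactors.card ≤ (pat n).card + U.card + 1 := by
      calc m.primeFactors.card ≤ (insert 2 (pat n ∪ U)).card := Finset.card_le_card hcover
        _ ≤ (pat n ∪ U).card + 1 := Finset.card_insert_le _ _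
        _ ≤ (pat n).card + U.card + 1 := by
            have := Finset.card_union_le (pat n) U; omega
    have hpat_le : (pat n).card ≤ m.primeFactors.card := hpatn ▸ Finset.card_filter_le _ _
    rw [Finset.mem_biUnion]
    refine ⟨j - (pat n).card, Finset.mem_range.2 (by omega), Finset.mem_filter.2 ⟨hnS, by omega⟩⟩
  calc (#(S.filter (fun n : ℕ =>
          ArithmeticFunction.cardDistinctFactors (f.eval (n : ℤ)).toNat = j)) : ℝ)
      ≤ #((Finset.range (L + 2)).biUnion (fun r =>
          S.filter (fun n : ℕ => (pat n).card = j - r))) := by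
        exact_mod_cast Finset.card_le_card hsub
    _ ≤ ∑ r ∈ Finset.range (L + 2), (#(S.filter (fun n : ℕ => (pat n).card = j - r)) : ℝ) := by
        exact_mod_cast Finset.card_biUnion_le
    _ ≤ ∑ _r ∈ Finset.range (L + 2), B := Finset.sum_le_sum fun r _ => hB _
    _ = (L + 2) * B := by rw [Finset.sum_const, Finset.card_range, nsmul_eq_mul]; push_cast; ring

/-- **The inputs attached to a quadratic with positive leading coefficient**: eventual positivity
and quadratic growth of the values. [folklore] -/
theorem exists_pos_and_growth (f : ℤ[X]) (hdeg : f.natDegree = 2) (hlc : 0 < f.leadingCoeff) :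
    ∃ N0 Cf : ℕ, (∀ n : ℕ, N0 < n → 0 < f.eval (n : ℤ)) ∧
      ∀ n : ℕ, 1 ≤ n → f.eval (n : ℤ) ≤ Cf * (n : ℤ) ^ 2 := by
  have hev : ∀ n : ℤ, f.eval n = f.coeff 0 + f.coeff 1 * n + f.coeff 2 * n ^ 2 := by
    intro n
    rw [Polynomial.eval_eq_sum_range, hdeg]
    simp [Finset.sum_range_succ]
  have hc2 : f.coeff 2 = f.leadingCoeff := by rw [Polynomial.leadingCoeff, hdeg]
  set c0 := f.coeff 0
  set c1 := f.coeff 1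
  set c2 := f.coeff 2
  have hc2' : 1 ≤ c2 := by rw [hc2]; omega
  refine ⟨(|c0| + |c1|).toNat, (|c0| + |c1| + c2).toNat, fun n hn => ?_, fun n hn => ?_⟩
  · have hnb : |c0| + |c1| < n := by
      have h : ¬ (n ≤ (|c0| + |c1|).toNat) := not_le.2 hn
      rw [Int.le_toNat (by positivity)] at h
      exact not_le.1 h
    rw [hev]
    have hn0 : (0 : ℤ) ≤ n := by positivity
    have h1 : -|c1| * n ≤ c1 * n := mul_le_mul_of_nonneg_right (neg_abs_le c1) hn0
    have h0 := neg_abs_le c0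
    have h2 : (n : ℤ) * (|c0| + |c1| + 1) ≤ c2 * n ^ 2 := by nlinarith
    nlinarith [abs_nonneg c0, abs_nonneg c1]
  · have hCf : (((|c0| + |c1| + c2).toNat : ℕ) : ℤ) = |c0| + |c1| + c2 :=
      Int.toNat_of_nonneg (by positivity)
    rw [hCf, hev]
    have hn1 : (1 : ℤ) ≤ n := by exact_mod_cast hn
    have hn0 : (0 : ℤ) ≤ n := by positivity
    have hn2 : (1 : ℤ) ≤ (n : ℤ) ^ 2 := by nlinarith
    have hnn : (n : ℤ) ≤ (n : ℤ) ^ 2 := by nlinarith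
    have h0 : c0 ≤ |c0| * n ^ 2 :=
      (le_abs_self c0).trans (le_mul_of_one_le_right (abs_nonneg c0) hn2)
    have h1 : c1 * n ≤ |c1| * n ^ 2 :=
      (mul_le_mul_of_nonneg_right (le_abs_self c1) hn0).trans
        (mul_le_mul_of_nonneg_left hnn (abs_nonneg c1))
    nlinarith

/-- `ρ(p) ≤ 2` at every prime for an irreducible quadratic. [folklore] -/
theorem rho_le_two {f : ℤ[X]} (hirr : Irreducible f) (hdeg : f.natDegree = 2) (p : ℕ) (hp : p.Prime) :
    polyRootCountMod ![f] p ≤ 2 := by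
  have h := polyRootCountMod_prime_le_natDegree_of_irreducible hirr (by omega) hp
  rwa [hdeg] at h

/-- **The model variance diverges**: `σ²(z) ≥ (2/3)(c log log(⌈z⌉ − 1) − C − 1/2)` for `z ≥ 3`,
from the tree's `Σ_{p ≤ y, ρ(p) = 2} 1/p ≥ c log log y − C` (the split primes). [folklore] -/
theorem exists_var_ge {f : ℤ[X]} (hirr : Irreducible f) (hdeg : f.natDegree = 2) :
    ∃ c : ℝ, 0 < c ∧ ∃ C : ℝ, ∀ z : ℝ, 3 ≤ z →
      (2 / 3) * (c * Real.log (Real.log ((⌈z⌉₊ - 1 : ℕ) : ℝ)) - C - 1 / 2) ≤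
        ∑ p ∈ (Nat.primesBelow ⌈z⌉₊).filter (fun p => 3 ≤ p),
          rootDensity f p * (1 - rootDensity f p) := by
  obtain ⟨c, hc, C, hC⟩ := exists_loglog_le_sum_inv_primes_rootCount_eq_natDegree hirr (by omega)
  refine ⟨c, hc, C, fun z hz => ?_⟩
  have hP : (Nat.primesBelow ⌈z⌉₊).filter (fun p => 3 ≤ p) =
      (Nat.primesBelow ⌈z⌉₊).filter (fun p => 3 ≤ p) := rfl
  rw [hdeg] at hC
  have h3 : 3 ≤ ⌈z⌉₊ := by
    have h := hz.trans (Nat.le_ceil z)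
    exact_mod_cast h
  have hN : 2 ≤ ⌈z⌉₊ - 1 := by omega
  have hCN := hC (⌈z⌉₊ - 1) hN
  -- the split primes `≤ ⌈z⌉ - 1` other than `2` are odd primes below `z`
  have hsub : (Nat.primesLE (⌈z⌉₊ - 1)).filter (fun p => polyRootCountMod ![f] p = 2) ⊆
      insert 2 (((Nat.primesBelow ⌈z⌉₊).filter (fun p => 3 ≤ p)).filter (fun p => polyRootCountMod ![f] p = 2)) := by
    intro p hp
    obtain ⟨hp1, hp2⟩ := Finset.mem_filter.1 hp
    obtain ⟨hpN, hpp⟩ := Nat.mem_primesLE.1 hp1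
    rw [Finset.mem_insert]
    by_cases h2 : p = 2
    · exact Or.inl h2
    · refine Or.inr (Finset.mem_filter.2 ⟨(mem_P hP).2 ⟨hpp, ?_, by omega⟩, hp2⟩)
      have := hpp.two_le; omega
  have h2notin : (2 : ℕ) ∉ ((Nat.primesBelow ⌈z⌉₊).filter (fun p => 3 ≤ p)).filter (fun p => polyRootCountMod ![f] p = 2) := by
    intro h
    have := ((mem_P hP).1 (Finset.mem_filter.1 h).1).2.1
    omega
  have hsum1 : ∑ p ∈ (Nat.primesLE (⌈z⌉₊ - 1)).filter (fun p => polyRootCountMod ![f] p = 2), (1 : ℝ) / p ≤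
      1 / 2 + ∑ p ∈ ((Nat.primesBelow ⌈z⌉₊).filter (fun p => 3 ≤ p)).filter (fun p => polyRootCountMod ![f] p = 2), (1 : ℝ) / p := by
    calc ∑ p ∈ (Nat.primesLE (⌈z⌉₊ - 1)).filter (fun p => polyRootCountMod ![f] p = 2), (1 : ℝ) / p
        ≤ ∑ p ∈ insert 2 (((Nat.primesBelow ⌈z⌉₊).filter (fun p => 3 ≤ p)).filter (fun p => polyRootCountMod ![f] p = 2)), (1 : ℝ) / p :=
          Finset.sum_le_sum_of_subset_of_nonneg hsub fun _ _ _ => by positivity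
      _ = 1 / 2 + ∑ p ∈ ((Nat.primesBelow ⌈z⌉₊).filter (fun p => 3 ≤ p)).filter (fun p => polyRootCountMod ![f] p = 2), (1 : ℝ) / p := by
          rw [Finset.sum_insert h2notin]; norm_num
  -- on the split odd primes `g(1 − g) ≥ (2/3)/p`
  have hsum2 : ∑ p ∈ ((Nat.primesBelow ⌈z⌉₊).filter (fun p => 3 ≤ p)).filter (fun p => polyRootCountMod ![f] p = 2), (1 : ℝ) / p ≤
      (3 / 2) * ∑ p ∈ (Nat.primesBelow ⌈z⌉₊).filter (fun p => 3 ≤ p),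
        rootDensity f p * (1 - rootDensity f p) := by
    rw [Finset.mul_sum]
    calc ∑ p ∈ ((Nat.primesBelow ⌈z⌉₊).filter (fun p => 3 ≤ p)).filter (fun p => polyRootCountMod ![f] p = 2), (1 : ℝ) / p
        ≤ ∑ p ∈ ((Nat.primesBelow ⌈z⌉₊).filter (fun p => 3 ≤ p)).filter (fun p => polyRootCountMod ![f] p = 2), (3 / 2) * (rootDensity f p * (1 - rootDensity f p)) := by
          refine Finset.sum_le_sum fun p hp => ?_
          obtain ⟨hpO, hρ⟩ := Finset.mem_filter.1 hp
          obtain ⟨hpp, hp3, -⟩ := (mem_P hP).1 hpO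
          have hp3' : (3 : ℝ) ≤ p := by exact_mod_cast hp3
          have hp0 : (0 : ℝ) < p := by linarith
          have hg : rootDensity f p = 2 / p := by
            rw [rootDensity_apply]
            rw [hρ]; norm_num
          rw [hg]
          rw [div_le_iff₀ hp0] 
          have h13 : (1 : ℝ) / 3 ≤ 1 - 2 / p := by
            rw [div_le_iff₀ (by norm_num : (0:ℝ) < 3)]
            have : 2 / (p : ℝ) ≤ 2 / 3 := div_le_div_of_nonneg_left (by norm_num) (by norm_num) hp3'
            linarith
          calc (1 : ℝ) = 3 / 2 * (2 / p * (1 / 3)) * p := by field_simp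
            _ ≤ 3 / 2 * (2 / p * (1 - 2 / p)) * p := by gcongr
      _ ≤ ∑ p ∈ (Nat.primesBelow ⌈z⌉₊).filter (fun p => 3 ≤ p),
          (3 / 2) * (rootDensity f p * (1 - rootDensity f p)) :=
          Finset.sum_le_sum_of_subset_of_nonneg (Finset.filter_subset _ _) fun p hp _ => by
            have h0 : 0 ≤ rootDensity f p := rootDensity_nonneg f p
            have h1 : rootDensity f p ≤ 1 := rootDensity_le_one f p
            have : 0 ≤ 1 - rootDensity f p := by linarith
            positivity
  linarith

/-- The numerical heart of the choice of `v`: `(3v+2)(e^{12} e^{−v/8} + 2C e^{−v/2}) ≤ ε/4` once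
`v ≥ 2560 (e^{12} + 2C)/ε` (using `e^{v/8} ≥ (v/8)²/2`). [folklore] -/
theorem main_const_le {C ε : ℝ} (hC : 0 ≤ C) (hε : 0 < ε) {v : ℕ} (hv1 : 1 ≤ v)
    (hvK : 2560 * (Real.exp 12 + 2 * C) / ε ≤ v) :
    (3 * (v : ℝ) + 2) * (Real.exp 12 * Real.exp (-((v : ℝ) / 8)) +
      2 * C * Real.exp (-((v : ℝ) / 2))) ≤ ε / 4 := by
  set K : ℝ := Real.exp 12 + 2 * C with hK
  have hK0 : 0 < K := by positivity
  have hv0 : (0 : ℝ) < v := by exact_mod_cast hv1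
  have h1 : ((v : ℝ) / 8) ^ 2 / 2 ≤ Real.exp ((v : ℝ) / 8) := by
    have := Real.pow_div_factorial_le_exp ((v : ℝ) / 8) (by positivity) 2
    simpa [Nat.factorial] using this
  have h2 : Real.exp (-((v : ℝ) / 2)) ≤ Real.exp (-((v : ℝ) / 8)) := Real.exp_le_exp.2 (by linarith)
  have h4 : (3 * (v : ℝ) + 2) ≤ 5 * v := by
    have : (1 : ℝ) ≤ v := by exact_mod_cast hv1
    linarith
  have h5 : Real.exp (-((v : ℝ) / 8)) ≤ 128 / (v : ℝ) ^ 2 := by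
    rw [Real.exp_neg, inv_le_comm₀ (Real.exp_pos _) (by positivity)]
    calc (128 / (v : ℝ) ^ 2)⁻¹ = ((v : ℝ) / 8) ^ 2 / 2 := by field_simp; ring
      _ ≤ _ := h1
  calc (3 * (v : ℝ) + 2) * (Real.exp 12 * Real.exp (-((v : ℝ) / 8)) + 2 * C * Real.exp (-((v : ℝ) / 2)))
      ≤ (5 * v) * (K * Real.exp (-((v : ℝ) / 8))) := by
        apply mul_le_mul h4 _ (by positivity) (by positivity)
        rw [hK, add_mul]
        have := mul_le_mul_of_nonneg_left h2 (by positivity : (0 : ℝ) ≤ 2 * C)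
        linarith
    _ ≤ (5 * v) * (K * (128 / (v : ℝ) ^ 2)) :=
        mul_le_mul_of_nonneg_left (mul_le_mul_of_nonneg_left h5 hK0.le) (by positivity)
    _ = 640 * K / v := by field_simp; ring
    _ ≤ ε / 4 := by
        rw [div_le_iff₀ hv0]
        have h := hvK
        rw [div_le_iff₀ hε] at h
        linarith

/-- The Rankin factor at the chosen parameters: for `2 ≤ N ≤ z`, `z = X^{1/v}`, `Y = X^{1/8}`,
`Y^{−1/log N} exp(2(e−1)(log N + log 4)/log N) ≤ e^{12} e^{−v/8}`. [folklore] -/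
theorem rankin_factor_le {X : ℝ} (hX : 1 < X) {v : ℕ} (hv : 1 ≤ v) {N : ℕ} (hN : 2 ≤ N)
    (hNz : (N : ℝ) ≤ X ^ ((v : ℝ)⁻¹)) :
    (X ^ ((8 : ℝ)⁻¹)) ^ (-(1 / Real.log N)) *
        Real.exp (2 * (Real.exp 1 - 1) / Real.log N * (Real.log N + Real.log 4)) ≤
      Real.exp 12 * Real.exp (-((v : ℝ) / 8)) := by
  have hX0 : 0 < X := by linarith
  have hlogX : 0 < Real.log X := Real.log_pos hX
  have hN2 : (2 : ℝ) ≤ N := by exact_mod_cast hN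
  have hlogN : Real.log 2 ≤ Real.log N := Real.log_le_log (by norm_num) hN2
  have hlog2 : 0 < Real.log 2 := Real.log_pos (by norm_num)
  have hlogN0 : 0 < Real.log N := lt_of_lt_of_le hlog2 hlogN
  have hv0 : (0 : ℝ) < v := by exact_mod_cast hv
  have hY : 0 < X ^ ((8 : ℝ)⁻¹) := Real.rpow_pos_of_pos hX0 _
  have hlogY : Real.log (X ^ ((8 : ℝ)⁻¹)) = (8 : ℝ)⁻¹ * Real.log X := Real.log_rpow hX0 _
  have hlogz : Real.log (X ^ ((v : ℝ)⁻¹)) = (v : ℝ)⁻¹ * Real.log X := Real.log_rpow hX0 _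
  have hlogNz : Real.log N ≤ (v : ℝ)⁻¹ * Real.log X := by
    rw [← hlogz]; exact Real.log_le_log (by linarith) hNz
  rw [mul_comm]
  refine mul_le_mul ?_ ?_ (Real.rpow_nonneg hY.le _) (Real.exp_pos _).le
  · -- the exponential factor
    refine Real.exp_le_exp.2 ?_
    have he : Real.exp 1 - 1 ≤ 2 := by have := Real.exp_one_lt_d9; norm_num at this; linarith
    have he0 : 0 ≤ Real.exp 1 - 1 := by linarith [Real.add_one_le_exp (1 : ℝ)]
    have hlog4 : Real.log 4 = 2 * Real.log 2 := by
      rw [show (4 : ℝ) = 2 ^ 2 by norm_num, Real.log_pow]; norm_num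
    rw [div_mul_eq_mul_div, div_le_iff₀ hlogN0, hlog4]
    nlinarith [hlogN, he, he0, hlog2]
  · -- the power of `Y`
    rw [Real.rpow_def_of_pos hY, hlogY]
    refine Real.exp_le_exp.2 ?_
    rw [show (8 : ℝ)⁻¹ * Real.log X * -(1 / Real.log N) = -((8 : ℝ)⁻¹ * Real.log X / Real.log N) by ring,
      neg_le_neg_iff, le_div_iff₀ hlogN0]
    calc (v : ℝ) / 8 * Real.log N ≤ (v : ℝ) / 8 * ((v : ℝ)⁻¹ * Real.log X) :=
          mul_le_mul_of_nonneg_left hlogNz (by positivity)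
      _ = (8 : ℝ)⁻¹ * Real.log X := by field_simp

/-- The junk terms at the chosen parameters: with `z = X^{1/v}`, `D = X^{1/2}`, `Y = X^{1/8}`,
`v ≥ 16`, `X > 1`: `Y (Y (D e⁸ log² z) + N₀ D) ≤ (e⁸ + N₀) X^{7/8}`. [folklore] -/
theorem junk_le {X : ℝ} (hX : 1 < X) {v : ℕ} (hv : 16 ≤ v) (N0 : ℕ) :
    X ^ ((8 : ℝ)⁻¹) * (X ^ ((8 : ℝ)⁻¹) * (X ^ ((2 : ℝ)⁻¹) *
        (Real.exp 8 * Real.log (X ^ ((v : ℝ)⁻¹)) ^ 2)) + N0 * X ^ ((2 : ℝ)⁻¹)) ≤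
      (Real.exp 8 + N0) * X ^ ((7 : ℝ) / 8) := by
  have hX0 : 0 < X := by linarith
  have hvR : (16 : ℝ) ≤ v := by exact_mod_cast hv
  have hv0 : (0 : ℝ) < v := by linarith
  have hz1 : 1 ≤ X ^ ((v : ℝ)⁻¹) := Real.one_le_rpow hX.le (inv_nonneg.2 hv0.le)
  have hz0 : 0 < X ^ ((v : ℝ)⁻¹) := by linarith
  have hYYD : X ^ ((8 : ℝ)⁻¹) * X ^ ((8 : ℝ)⁻¹) * X ^ ((2 : ℝ)⁻¹) = X ^ ((3 : ℝ) / 4) := by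
    rw [← Real.rpow_add hX0, ← Real.rpow_add hX0]; norm_num
  have hYD : X ^ ((8 : ℝ)⁻¹) * X ^ ((2 : ℝ)⁻¹) = X ^ ((5 : ℝ) / 8) := by
    rw [← Real.rpow_add hX0]; norm_num
  have hlog0 : 0 ≤ Real.log (X ^ ((v : ℝ)⁻¹)) := Real.log_nonneg hz1
  have hlogle : Real.log (X ^ ((v : ℝ)⁻¹)) ^ 2 ≤ X ^ ((8 : ℝ)⁻¹) := by
    have h1 : Real.log (X ^ ((v : ℝ)⁻¹)) ≤ X ^ ((v : ℝ)⁻¹) := by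
      have := Real.log_le_sub_one_of_pos hz0; linarith
    calc Real.log (X ^ ((v : ℝ)⁻¹)) ^ 2 ≤ (X ^ ((v : ℝ)⁻¹)) ^ 2 := pow_le_pow_left₀ hlog0 h1 2
      _ = X ^ ((v : ℝ)⁻¹ * 2) := by
          rw [Real.rpow_mul hX0.le, Real.rpow_two]
      _ ≤ X ^ ((8 : ℝ)⁻¹) := by
          refine Real.rpow_le_rpow_of_exponent_le hX.le ?_
          rw [inv_mul_le_iff₀ hv0]; linarith
  have h58 : X ^ ((5 : ℝ) / 8) ≤ X ^ ((7 : ℝ) / 8) :=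
    Real.rpow_le_rpow_of_exponent_le hX.le (by norm_num)
  have h34 : X ^ ((3 : ℝ) / 4) * X ^ ((8 : ℝ)⁻¹) = X ^ ((7 : ℝ) / 8) := by
    rw [← Real.rpow_add hX0]; norm_num
  have hx34 : 0 ≤ X ^ ((3 : ℝ) / 4) := Real.rpow_nonneg hX0.le _
  calc X ^ ((8 : ℝ)⁻¹) * (X ^ ((8 : ℝ)⁻¹) * (X ^ ((2 : ℝ)⁻¹) *
        (Real.exp 8 * Real.log (X ^ ((v : ℝ)⁻¹)) ^ 2)) + N0 * X ^ ((2 : ℝ)⁻¹))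
      = Real.exp 8 * ((X ^ ((8 : ℝ)⁻¹) * X ^ ((8 : ℝ)⁻¹) * X ^ ((2 : ℝ)⁻¹)) *
          Real.log (X ^ ((v : ℝ)⁻¹)) ^ 2) + N0 * (X ^ ((8 : ℝ)⁻¹) * X ^ ((2 : ℝ)⁻¹)) := by ring
    _ ≤ Real.exp 8 * (X ^ ((3 : ℝ) / 4) * X ^ ((8 : ℝ)⁻¹)) + N0 * X ^ ((7 : ℝ) / 8) := by
        rw [hYYD, hYD]
        exact add_le_add (mul_le_mul_of_nonneg_left (mul_le_mul_of_nonneg_left hlogle hx34)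
          (Real.exp_pos _).le) (mul_le_mul_of_nonneg_left h58 (Nat.cast_nonneg _))
    _ = (Real.exp 8 + N0) * X ^ ((7 : ℝ) / 8) := by rw [h34]; ring

/-- `A⁸ ≤ X` gives `A X^{7/8} ≤ X`. [folklore] -/
theorem mul_rpow_seven_eighths_le {A X : ℝ} (hA : 0 ≤ A) (hX : 0 < X) (hAX : A ^ 8 ≤ X) :
    A * X ^ ((7 : ℝ) / 8) ≤ X := by
  have h1 : A ≤ X ^ ((8 : ℝ)⁻¹) := by
    have h := Real.rpow_le_rpow (pow_nonneg hA 8) hAX (by norm_num : (0 : ℝ) ≤ (8 : ℝ)⁻¹)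
    have h8 : (A ^ 8) ^ ((8 : ℝ)⁻¹) = A := by
      have := Real.pow_rpow_inv_natCast hA (n := 8) (by norm_num)
      rw [show (((8 : ℕ) : ℝ)⁻¹) = (8 : ℝ)⁻¹ by norm_num] at this
      exact this
    rwa [h8] at h
  calc A * X ^ ((7 : ℝ) / 8) ≤ X ^ ((8 : ℝ)⁻¹) * X ^ ((7 : ℝ) / 8) :=
        mul_le_mul_of_nonneg_right h1 (Real.rpow_nonneg hX.le _)
    _ = X := by rw [← Real.rpow_add hX]; norm_num

/-- The values are `< z^{3v+1}`: `0 < f(n) ≤ C_f n² ≤ C_f X² < X³ ≤ z^{3v+1}` for `n ≤ X`,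
`C_f < X`. [folklore] -/
theorem values_lt (hS : S = (Ioc 0 x).filter (fun n : ℕ => 0 < f.eval (n : ℤ))) {Cf : ℕ} (hCf : ∀ n : ℕ, 1 ≤ n → f.eval (n : ℤ) ≤ Cf * (n : ℤ) ^ 2)
    (hxCf : (Cf : ℝ) + 1 ≤ x) {v : ℕ} (hv : 1 ≤ v) :
    ∀ n ∈ S, (((f.eval (n : ℤ)).toNat : ℕ) : ℝ) < ((x : ℝ) ^ ((v : ℝ)⁻¹)) ^ (3 * v + 1) := by
  intro n hn
  have hX1 : (1 : ℝ) ≤ x := by linarith [(Nat.cast_nonneg Cf : (0 : ℝ) ≤ Cf)]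
  have hX0 : (0 : ℝ) < x := by linarith
  have hv0 : (0 : ℝ) < v := by exact_mod_cast hv
  rw [hS] at hn
  obtain ⟨hnI, hpos⟩ := Finset.mem_filter.1 hn
  obtain ⟨hn0, hnx⟩ := Finset.mem_Ioc.1 hnI
  have hcast : (((f.eval (n : ℤ)).toNat : ℕ) : ℝ) = ((f.eval (n : ℤ) : ℤ) : ℝ) := by
    have h := Int.toNat_of_nonneg hpos.le
    exact_mod_cast congrArg (fun t : ℤ => (t : ℝ)) h
  rw [hcast]
  have h1 : ((f.eval (n : ℤ) : ℤ) : ℝ) ≤ Cf * (n : ℝ) ^ 2 := by exact_mod_cast hCf n hn0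
  have h2 : (n : ℝ) ≤ x := by exact_mod_cast hnx
  have hn0' : (0 : ℝ) ≤ n := Nat.cast_nonneg n
  have h3 : (Cf : ℝ) * (n : ℝ) ^ 2 ≤ Cf * (x : ℝ) ^ 2 :=
    mul_le_mul_of_nonneg_left (pow_le_pow_left₀ hn0' h2 2) (Nat.cast_nonneg _)
  have h4 : (Cf : ℝ) * (x : ℝ) ^ 2 < (x : ℝ) ^ 3 := by
    have : (Cf : ℝ) < x := by linarith
    have hx2 : (0 : ℝ) < (x : ℝ) ^ 2 := by positivity
    nlinarith
  have h5 : (x : ℝ) ^ 3 ≤ ((x : ℝ) ^ ((v : ℝ)⁻¹)) ^ (3 * v + 1) := by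
    rw [← Real.rpow_natCast ((x : ℝ) ^ ((v : ℝ)⁻¹)), ← Real.rpow_mul hX0.le,
      ← Real.rpow_natCast (x : ℝ) 3]
    refine Real.rpow_le_rpow_of_exponent_le hX1 ?_
    rw [show ((v : ℝ)⁻¹ * ((3 * v + 1 : ℕ) : ℝ)) = 3 + (v : ℝ)⁻¹ by push_cast; field_simp]
    push_cast
    linarith [inv_nonneg.2 hv0.le]
  linarith

/-- Monotonicity of `log log`: if `exp(exp L₀) + 1 ≤ z` then `L₀ ≤ log log (⌈z⌉ − 1)`. [folklore] -/
theorem le_loglog_of_le {L₀ z : ℝ} (hz : Real.exp (Real.exp L₀) + 1 ≤ z) :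
    L₀ ≤ Real.log (Real.log ((⌈z⌉₊ - 1 : ℕ) : ℝ)) := by
  have hz0 : 0 < z := by linarith [Real.exp_pos (Real.exp L₀)]
  have hceil : Real.exp (Real.exp L₀) ≤ ((⌈z⌉₊ - 1 : ℕ) : ℝ) := by
    have h1 : (1 : ℕ) ≤ ⌈z⌉₊ := Nat.one_le_iff_ne_zero.2 (Nat.pos_iff_ne_zero.1 (Nat.ceil_pos.2 hz0))
    rw [Nat.cast_sub h1, Nat.cast_one]
    linarith [Nat.le_ceil z]
  have h1 : Real.exp L₀ ≤ Real.log ((⌈z⌉₊ - 1 : ℕ) : ℝ) := by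
    rw [← Real.log_exp (Real.exp L₀)]
    exact Real.log_le_log (Real.exp_pos _) hceil
  calc L₀ = Real.log (Real.exp L₀) := (Real.log_exp _).symm
    _ ≤ _ := Real.log_le_log (Real.exp_pos _) h1

/-- The final count: the progression condition is dropped and the nonpositive values absorbed. [folklore] -/
theorem card_le_N0_add (hS : S = (Ioc 0 x).filter (fun n : ℕ => 0 < f.eval (n : ℤ))) {N0 : ℕ} (hN0 : ∀ n : ℕ, N0 < n → 0 < f.eval (n : ℤ)) (q a j : ℕ) :
    ((((Finset.Icc 1 x).filter (fun n : ℕ => n ≡ a [MOD q] ∧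
        ArithmeticFunction.cardDistinctFactors ((f.eval (n : ℤ)).toNat) = j)).card : ℕ) : ℝ) ≤
      N0 + #(S.filter (fun n : ℕ =>
        ArithmeticFunction.cardDistinctFactors (f.eval (n : ℤ)).toNat = j)) := by
  have hIcc : Finset.Icc 1 x = Finset.Ioc 0 x := by
    ext n; simp only [Finset.mem_Icc, Finset.mem_Ioc]; omega
  have hsub : (Finset.Icc 1 x).filter (fun n : ℕ => n ≡ a [MOD q] ∧
      ArithmeticFunction.cardDistinctFactors ((f.eval (n : ℤ)).toNat) = j) ⊆
      Finset.Ioc 0 N0 ∪ S.filter (fun n : ℕ =>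
        ArithmeticFunction.cardDistinctFactors (f.eval (n : ℤ)).toNat = j) := by
    intro n hn
    rw [hIcc] at hn
    obtain ⟨hnI, -, hω'⟩ := Finset.mem_filter.1 hn
    rw [Finset.mem_union]
    by_cases hpos : 0 < f.eval (n : ℤ)
    · exact Or.inr (Finset.mem_filter.2 ⟨by rw [hS]; exact Finset.mem_filter.2 ⟨hnI, hpos⟩, hω'⟩)
    · left
      rw [Finset.mem_Ioc] at hnI ⊢
      refine ⟨hnI.1, ?_⟩
      by_contra hlt
      exact hpos (hN0 n (not_le.1 hlt))
  calc ((((Finset.Icc 1 x).filter (fun n : ℕ => n ≡ a [MOD q] ∧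
          ArithmeticFunction.cardDistinctFactors ((f.eval (n : ℤ)).toNat) = j)).card : ℕ) : ℝ)
      ≤ ((Finset.Ioc 0 N0 ∪ S.filter (fun n : ℕ =>
          ArithmeticFunction.cardDistinctFactors (f.eval (n : ℤ)).toNat = j)).card : ℝ) := by
        exact_mod_cast Finset.card_le_card hsub
    _ ≤ (N0 : ℝ) + #(S.filter (fun n : ℕ =>
          ArithmeticFunction.cardDistinctFactors (f.eval (n : ℤ)).toNat = j)) := by
        have h := Finset.card_union_le (Finset.Ioc 0 N0) (S.filter (fun n : ℕ =>
          ArithmeticFunction.cardDistinctFactors (f.eval (n : ℤ)).toNat = j))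
        rw [Nat.card_Ioc, Nat.sub_zero] at h
        exact_mod_cast h

/-- **The bound at fixed `x`**, all parameters chosen: `z = x^{1/v}`, `D = x^{1/2}`, `Y = x^{1/8}`
(`C` the constant of the Fundamental Lemma). [folklore] -/
theorem card_pos_part_le (hS : S = (Ioc 0 x).filter (fun n : ℕ => 0 < f.eval (n : ℤ))) {C : ℝ}
    (hC : 0 < C) (hFL : ∀ A : SieveSequence,
      HasSieveDimension A.density (2 * (2 : ℕ))
        (((2 * 2 + 1 : ℕ) : ℝ) ^ (2 * 2 + 1) * Real.exp (2 * (2 : ℕ) * (9 / 2 + 6 / Real.log 2))) →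
      ∀ x z D : ℝ, 2 ≤ z → z ≤ D → 0 ≤ A.size x →
        |A.sifted x (primesProdBelow z) - A.size x * A.densityProduct (primesProdBelow z)| ≤
          C * A.size x * A.densityProduct (primesProdBelow z) *
              Real.exp (-(Real.log D / Real.log z)) +
            ∑ d ∈ (primesProdBelow z).divisors.filter (fun d : ℕ => (d : ℝ) ≤ D), |A.remainder d x|)
    (hρ2 : ∀ p : ℕ, p.Prime → polyRootCountMod ![f] p ≤ 2) {N0 Cf : ℕ}
    (hN0 : ∀ n : ℕ, N0 < n → 0 < f.eval (n : ℤ))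
    (hCf : ∀ n : ℕ, 1 ≤ n → f.eval (n : ℤ) ≤ Cf * (n : ℤ) ^ 2) {ε : ℝ} (hε : 0 < ε) {v : ℕ}
    (hv16 : 16 ≤ v) (hvK : 2560 * (Real.exp 12 + 2 * C) / ε ≤ v) (hX3 : (3 : ℝ) ≤ x)
    (hxCf : (Cf : ℝ) + 1 ≤ x)
    (hxX₂ : (8 * (3 * v + 2) * (Real.exp 8 + N0) / ε) ^ 8 ≤ (x : ℝ))
    (hz3 : 3 ≤ (x : ℝ) ^ ((v : ℝ)⁻¹))
    (hvarV : π / (8 * (ε / (4 * (3 * v + 2))) ^ 2) ≤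
      ∑ p ∈ (Nat.primesBelow ⌈(x : ℝ) ^ ((v : ℝ)⁻¹)⌉₊).filter (fun p => 3 ≤ p),
        rootDensity f p * (1 - rootDensity f p))
    (j : ℕ) :
    (#(S.filter (fun n : ℕ =>
      ArithmeticFunction.cardDistinctFactors (f.eval (n : ℤ)).toNat = j)) : ℝ) ≤ 3 * (ε / 4) * x := by
  have hv1 : 1 ≤ v := by omega
  have hvR : (16 : ℝ) ≤ v := by exact_mod_cast hv16
  have hv0 : (0 : ℝ) < v := by linarith
  have hX1 : (1 : ℝ) < x := by linarith
  have hX0 : (0 : ℝ) < x := by linarith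
  have hlogX : 0 < Real.log x := Real.log_pos hX1
  set z : ℝ := (x : ℝ) ^ ((v : ℝ)⁻¹) with hzdef
  set D : ℝ := (x : ℝ) ^ ((2 : ℝ)⁻¹) with hDdef
  set Y : ℝ := (x : ℝ) ^ ((8 : ℝ)⁻¹) with hYdef
  set δ : ℝ := ε / (4 * (3 * v + 2)) with hδ
  have hδ0 : 0 < δ := by positivity
  have hz2 : 2 ≤ z := by linarith
  have hz1 : 1 < z := by linarith
  have hz0 : 0 < z := by linarith
  have hlogz : Real.log z = (v : ℝ)⁻¹ * Real.log x := Real.log_rpow hX0 _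
  have hlogD : Real.log D = (2 : ℝ)⁻¹ * Real.log x := Real.log_rpow hX0 _
  have hzD : z ≤ D :=
    Real.rpow_le_rpow_of_exponent_le hX1.le (inv_anti₀ (by norm_num) (by linarith))
  have hY0 : 0 < Y := Real.rpow_pos_of_pos hX0 _
  have hεs : Real.exp (-(Real.log D / Real.log z)) = Real.exp (-((v : ℝ) / 2)) := by
    rw [hlogD, hlogz]; congr 2; field_simp
  -- variance and the Gaussian atom bound
  have hV0 : 0 < π / (8 * δ ^ 2) := by positivity
  have hvar0 : 0 < ∑ p ∈ (Nat.primesBelow ⌈z⌉₊).filter (fun p => 3 ≤ p),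
      rootDensity f p * (1 - rootDensity f p) := lt_of_lt_of_le hV0 hvarV
  have hsqrt : Real.sqrt (π / (8 * ∑ p ∈ (Nat.primesBelow ⌈z⌉₊).filter (fun p => 3 ≤ p),
      rootDensity f p * (1 - rootDensity f p))) ≤ δ := by
    refine Real.sqrt_le_iff.2 ⟨hδ0.le, ?_⟩
    calc π / (8 * ∑ p ∈ (Nat.primesBelow ⌈z⌉₊).filter (fun p => 3 ≤ p),
        rootDensity f p * (1 - rootDensity f p)) ≤ π / (8 * (π / (8 * δ ^ 2))) :=
          div_le_div_of_nonneg_left Real.pi_pos.le (by positivity)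
            (mul_le_mul_of_nonneg_left hvarV (by norm_num))
      _ = δ ^ 2 := by field_simp
  -- Rankin factor
  have hN2 : 2 ≤ ⌊z⌋₊ := Nat.le_floor (by exact_mod_cast hz2)
  have hNz : ((⌊z⌋₊ : ℕ) : ℝ) ≤ z := Nat.floor_le hz0.le
  have hrank := rankin_factor_le hX1 hv1 hN2 hNz
  -- the cell bound, the values, the cells-to-ω step
  have hcell := fun i => cell_le (f := f) (x := x) (z := z)
    (P := (Nat.primesBelow ⌈z⌉₊).filter (fun p => 3 ≤ p))
    (pat := fun n : ℕ => ((f.eval (n : ℤ)).toNat.primeFactors).filter (fun p => 3 ≤ p ∧ p < ⌈z⌉₊))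
    (S := S) (E := fun T => #(S.filter (fun n : ℕ =>
      ((f.eval (n : ℤ)).toNat.primeFactors).filter (fun p => 3 ≤ p ∧ p < ⌈z⌉₊) = T)))
    (M := fun T => (∏ p ∈ T, rootDensity f p) *
      ∏ p ∈ ((Nat.primesBelow ⌈z⌉₊).filter (fun p => 3 ≤ p)) \ T, (1 - rootDensity f p))
    rfl (fun _ => rfl) hS (fun _ => rfl) (fun _ => rfl) hC.le hFL hρ2 hN0 hz2 hzD hY0 hvar0 i
  have hval := values_lt hS hCf hxCf hv1
  have hω := card_omega_le (z := z)
    (pat := fun n : ℕ => ((f.eval (n : ℤ)).toNat.primeFactors).filter (fun p => 3 ≤ p ∧ p < ⌈z⌉₊))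
    (fun _ => rfl) hS hz1 hval (fun i => hcell i) j
  -- the junk terms
  have hjunk := junk_le hX1 hv16 N0
  have hA0 : 0 ≤ 8 * (3 * v + 2) * (Real.exp 8 + N0) / ε := by positivity
  have hx78 := mul_rpow_seven_eighths_le hA0 hX0 hxX₂
  have hmain := main_const_le hC.le hε hv1 hvK
  -- assembling
  refine hω.trans ?_
  have hB : (x : ℝ) * (Real.sqrt (π / (8 * ∑ p ∈ (Nat.primesBelow ⌈z⌉₊).filter (fun p => 3 ≤ p),
        rootDensity f p * (1 - rootDensity f p))) +
        Y ^ (-(1 / Real.log ⌊z⌋₊)) *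
          Real.exp (2 * (Real.exp 1 - 1) / Real.log ⌊z⌋₊ * (Real.log ⌊z⌋₊ + Real.log 4))) +
      2 * (C * x * Real.exp (-(Real.log D / Real.log z)) +
        Y * (Y * (D * (Real.exp 8 * Real.log z ^ 2)) + N0 * D)) ≤
      x * (δ + Real.exp 12 * Real.exp (-((v : ℝ) / 8))) +
        2 * (C * x * Real.exp (-((v : ℝ) / 2)) + (Real.exp 8 + N0) * (x : ℝ) ^ ((7 : ℝ) / 8)) := by
    rw [hεs]
    exact add_le_add (mul_le_mul_of_nonneg_left (add_le_add hsqrt hrank) hX0.le)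
      (mul_le_mul_of_nonneg_left (add_le_add le_rfl hjunk) (by norm_num))
  have hv32 : (0 : ℝ) ≤ 3 * v + 2 := by positivity
  have h1 : (3 * (v : ℝ) + 2) * δ = ε / 4 := by rw [hδ]; field_simp
  have h2 := mul_le_mul_of_nonneg_left hmain hX0.le
  have h3 := mul_le_mul_of_nonneg_right hx78 (by positivity : (0 : ℝ) ≤ ε / 4)
  calc (((3 * v : ℕ) : ℝ) + 2) * _ ≤ (3 * (v : ℝ) + 2) * (x * (δ + Real.exp 12 * Real.exp (-((v : ℝ) / 8))) +
        2 * (C * x * Real.exp (-((v : ℝ) / 2)) + (Real.exp 8 + N0) * (x : ℝ) ^ ((7 : ℝ) / 8))) := by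
        push_cast
        exact mul_le_mul_of_nonneg_left hB hv32
    _ = x * ((3 * (v : ℝ) + 2) * δ) +
          x * ((3 * (v : ℝ) + 2) * (Real.exp 12 * Real.exp (-((v : ℝ) / 8)) +
            2 * C * Real.exp (-((v : ℝ) / 2)))) +
          (8 * (3 * (v : ℝ) + 2) * (Real.exp 8 + N0) / ε) * (x : ℝ) ^ ((7 : ℝ) / 8) * (ε / 4) := by
        field_simp
        ring
    _ ≤ x * (ε / 4) + x * (ε / 4) + x * (ε / 4) := by rw [h1]; linarith
    _ = 3 * (ε / 4) * x := by ring

end Final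

/-- **No atom for `ω(f(n))` along an irreducible quadratic**: for every irreducible `f ∈ ℤ[X]` of
degree `2` with positive leading coefficient, every progression `a mod q` and every `ε > 0`, once
`x` is large no single value `j` of `ω(f(n))` is taken by more than `εx` of the `n ≤ x`,
`n ≡ a (mod q)`. The anti-concentration half of the Erdős–Kac law for `ω(f(n))` (Halberstam 1956,
proved there by the method of moments); proved here from the Kubilius model at level `x^{1/v}` via
the tree's uniform Fundamental Lemma and a Fourier bound for the model. [folklore] -/
theorem quadratic_omega_no_atom :
    ∀ f : Polynomial ℤ, Irreducible f → f.natDegree = 2 → 0 < f.leadingCoeff → ∀ q a : ℕ, 0 < q →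
      ∀ ε : ℝ, 0 < ε → ∀ᶠ x : ℕ in Filter.atTop, ∀ j : ℕ,
        ((((Finset.Icc 1 x).filter (fun n : ℕ => n ≡ a [MOD q] ∧
            ArithmeticFunction.cardDistinctFactors ((f.eval (n : ℤ)).toNat) = j)).card : ℕ) : ℝ)
          ≤ ε * x := by
  intro f hirr hdeg hlc q a _hq ε hε
  -- the inputs attached to `f`
  obtain ⟨N0, Cf, hN0, hCf⟩ := exists_pos_and_growth f hdeg hlc
  have hρ2 := rho_le_two hirr hdeg
  obtain ⟨c, hc, Csp, hvar⟩ := exists_var_ge hirr hdeg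
  obtain ⟨C, hC, hFL⟩ := exists_FL_const
  -- the choice of `v`
  obtain ⟨v, hv16, hvK⟩ : ∃ v : ℕ, 16 ≤ v ∧ 2560 * (Real.exp 12 + 2 * C) / ε ≤ v :=
    ⟨max 16 ⌈2560 * (Real.exp 12 + 2 * C) / ε⌉₊, le_max_left _ _,
      (Nat.le_ceil _).trans (by exact_mod_cast le_max_right _ _)⟩
  have hvR : (16 : ℝ) ≤ v := by exact_mod_cast hv16
  have hv0 : (0 : ℝ) < v := by linarith
  -- the thresholds
  have hV0 : 0 < π / (8 * (ε / (4 * (3 * (v : ℝ) + 2))) ^ 2) := by positivity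
  obtain ⟨Z₀, hZ₀3, hZ₀⟩ : ∃ Z₀ : ℝ, 3 ≤ Z₀ ∧ ∀ z : ℝ, Z₀ ≤ z →
      π / (8 * (ε / (4 * (3 * (v : ℝ) + 2))) ^ 2) ≤
        ∑ p ∈ (Nat.primesBelow ⌈z⌉₊).filter (fun p => 3 ≤ p), rootDensity f p * (1 - rootDensity f p) := by
    refine ⟨max 3 (Real.exp (Real.exp ((3 * (π / (8 * (ε / (4 * (3 * (v : ℝ) + 2))) ^ 2)) / 2 +
      Csp + 1 / 2) / c)) + 1), le_max_left _ _, fun z hz => ?_⟩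
    have hz3 : 3 ≤ z := (le_max_left _ _).trans hz
    refine le_trans ?_ (hvar z hz3)
    have hLL := le_loglog_of_le ((le_max_right _ _).trans hz)
    have h2 := mul_le_mul_of_nonneg_left hLL hc.le
    rw [mul_div_cancel₀ _ hc.ne'] at h2
    linarith
  have hZ₀0 : 0 ≤ Z₀ := by linarith
  obtain ⟨X₀, hX₀⟩ : ∃ X₀ : ℕ, max (Z₀ ^ v) (max ((8 * (3 * v + 2) * (Real.exp 8 + N0) / ε) ^ 8)
      (max (4 * (N0 : ℝ) / ε) ((Cf : ℝ) + 1))) ≤ X₀ := ⟨_, Nat.le_ceil _⟩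
  refine Filter.eventually_atTop.2 ⟨X₀, fun x hx j => ?_⟩
  have hxR := hX₀.trans (show (X₀ : ℝ) ≤ x by exact_mod_cast hx)
  have hxZ : Z₀ ^ v ≤ (x : ℝ) := le_trans (le_max_left _ _) hxR
  have hxX₂ : (8 * (3 * v + 2) * (Real.exp 8 + N0) / ε) ^ 8 ≤ (x : ℝ) :=
    le_trans (le_trans (le_max_left _ _) (le_max_right _ _)) hxR
  have hxN0 : 4 * (N0 : ℝ) / ε ≤ (x : ℝ) :=
    le_trans (le_trans (le_trans (le_max_left _ _) (le_max_right _ _)) (le_max_right _ _)) hxR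
  have hxCf : (Cf : ℝ) + 1 ≤ (x : ℝ) :=
    le_trans (le_trans (le_trans (le_max_right _ _) (le_max_right _ _)) (le_max_right _ _)) hxR
  have hX3 : (3 : ℝ) ≤ x := by
    calc (3 : ℝ) ≤ Z₀ := hZ₀3
      _ ≤ Z₀ ^ v := le_self_pow₀ (by linarith) (by omega)
      _ ≤ x := hxZ
  have hzZ : Z₀ ≤ (x : ℝ) ^ ((v : ℝ)⁻¹) := by
    have h := Real.rpow_le_rpow (pow_nonneg hZ₀0 v) hxZ (inv_nonneg.2 hv0.le)
    rwa [Real.pow_rpow_inv_natCast hZ₀0 (by omega)] at h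
  have hpos_part := card_pos_part_le (S := (Ioc 0 x).filter (fun n : ℕ => 0 < f.eval (n : ℤ))) rfl
    hC hFL hρ2 hN0 hCf hε hv16 hvK hX3 hxCf hxX₂ (hZ₀3.trans hzZ) (hZ₀ _ hzZ) j
  have hN0x : (N0 : ℝ) ≤ ε / 4 * x := by
    rw [div_le_iff₀ hε] at hxN0; linarith
  calc ((((Finset.Icc 1 x).filter (fun n : ℕ => n ≡ a [MOD q] ∧
          ArithmeticFunction.cardDistinctFactors ((f.eval (n : ℤ)).toNat) = j)).card : ℕ) : ℝ)
      ≤ N0 + #(((Ioc 0 x).filter (fun n : ℕ => 0 < f.eval (n : ℤ))).filter (fun n : ℕ =>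
          ArithmeticFunction.cardDistinctFactors (f.eval (n : ℤ)).toNat = j)) :=
        card_le_N0_add (S := (Ioc 0 x).filter (fun n : ℕ => 0 < f.eval (n : ℤ))) rfl hN0 q a j
    _ ≤ ε / 4 * x + 3 * (ε / 4) * x := add_le_add hN0x hpos_part
    _ = ε * x := by ring

end PolynomialOmegaNoAtom

end Literature.NumberTheory.Sieve
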